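import Literature.NumberTheory.LFunctions.PrimitiveQuadraticCharacterEulerForm
import Literature.NumberTheory.LFunctions.QuadraticBernoulliCertificatesOdd
import Literature.NumberTheory.LFunctions.QuadraticBernoulliCertificatesEven
import Literature.NumberTheory.LFunctions.BernoulliOneCharOddPrimitiveBound
import HarnessLib

/-!
# The odd primitive quadratic characters with `6|B_{1,ψ}| ≥ φ(f)` (resp. `ψ(2) = −1` and `12|B_{1,ψ}| ≥ φ(f)`):
# conductors `{3, 4, 7, 8, 15, 20, 24, 39, 56, 84}` (resp. `{3, 11, 35}`)

Topic `Literature/NumberTheory/LFunctions`, namespace `Literature.NumberTheory.LFunctions.PrimitiveQuadratic`.  Everything here is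
PROVED (theorems only, no definitions, no named facts, no `sorry`).

THE STATEMENT (class numbers of imaginary quadratic fields in the normalisation `|B_{1,χ_D}| = 2h(D)/w(D)`).  For an odd primitive
quadratic Dirichlet character `ψ` of conductor `f` — equivalently `ψ = (D/·)` with `D = −f` a negative fundamental discriminant
(Montgomery–Vaughan Thm. 9.13; the tree's `PrimitiveQuadraticCharacterKronecker.lean`) — `|B_{1,ψ}| = h(D)` for `f > 4` and
`= 1/3, 1/2` for `f = 3, 4`, and:

* **`φ(f) ≤ 6·|B_{1,ψ}|` only if `f ∈ {3, 4, 7, 8, 15, 20, 24, 39, 56, 84}`** (`mem_of_totient_le_six_mul_norm_bernoulliOneChar`);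
* **for odd `f` with `ψ(2) = −1` (i.e. `f ≡ 3 (mod 8)`): `φ(f) ≤ 12·|B_{1,ψ}|` only if `f ∈ {3, 11, 35}`**
  (`eq_of_totient_le_twelve_mul_norm_bernoulliOneChar`);
* conversely the values `|B_{1,ψ}| = 1/3, 1/2, 1, 1, 1, 2, 2, 2, 2, 4, 4, 4` at `f = 3, 4, 7, 8, 11, 15, 20, 24, 35, 39, 56, 84`
  (`norm_bernoulliOneChar_eq_of_eq_*`), all of which do satisfy the respective inequality.

These are the class-number inputs of Koblitz's list [kob] of levels of Fermat quotient curves with a Jacobian factor of elliptic type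
(`Literature/AlgebraicGeometry/ComplexMultiplication/CyclotomicFermatCMTypesKoblitzList*`: the master inequality forces the conductor
of the odd quadratic character of a group triple into one of the two lists).

THE PROOF.  `|B_{1,ψ}| ≤ π⁻¹√f log f` (Oesterlé (27); the tree's `BernoulliOneCharOddPrimitiveBound`) gives `φ(f) ≤ (12/π)√f log f`,
whence `f < 2²¹` (`f ≤ φ(f)(⌊log₂f⌋ + 1)`, as in the Koblitz-list file `…KoblitzListConductorFinite`); the odd part `m` of `f` is
squarefree with at most four prime factors `≥ 19` (`19⁵ > 2²¹`), so `φ(m)/m ≥ ∏_{3≤p≤17}(1 − 1/p)·(18/19)⁴ > 0.2908` and the inequality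
`0.2908·f ≤ (12/π)√f log f` fails for `f ≥ 2·10⁴`; below `2·10⁴` the kernel sweeps of `QuadraticBernoulliCertificates{Odd,Even}` either
verify the analytic criterion with the exact totient (`totient_eq_trialDivision`), or point to a kernel certificate `12|B_{1,ψ}| < φ(f)` /
`6|B_{1,ψ}| < φ(f)` — read through the Euler-criterion form of `ψ` (`PrimitiveQuadraticCharacterEulerForm`) and the half-sum formulas
`3B_{1,ψ} = −Σ_{b<f/2}ψ(b)` (`f ≡ 3 (8)`), `B_{1,ψ} = −Σ_{b<f/2}ψ(b)` (`f ≡ 7 (8)`), `B_{1,ψ} = −½Σ_{b<f/2}ψ(b)` (`f` even; proved here from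
`ψ(b + f/2) = −ψ(b)`) — or `f` is one of the listed conductors.

## What is proved

* §1 (helpers, mostly private) `prime_of_trialDivision`, `totient_eq_trialDivision` (the totient of an odd squarefree `n < 149²` as evaluated by the
  sweeps), `two_mul_log_le_table` (`2 log f ≤ L(f)`), `lt_two_pow_of_totient_le` (`φ(f) ≤ (12/π)√f log f ⟹ f < 2²¹`),
  `totient_ge_of_odd_squarefree` (`φ(m) ≥ 0.2908·m`, `m` odd squarefree `< 19⁵`), `not_le_twelve_mul_of_le` (no `f ≥ 2·10⁴` has
  `0.2908f ≤ (12/π)√f log f`).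
* §2 **`apply_one_add_half_eq_neg_one`**, **`apply_natCast_add_half`** (`ψ(b + f/2) = −ψ(b)`, `4 ∣ f`),
  **`norm_bernoulliOneChar_eq_natAbs_halfSum_div_two`** (`|B_{1,ψ}| = |Σ_{b<f/2}F(b)|/2`).
* §3 the twelve values `norm_bernoulliOneChar_eq_of_eq_three`, …, `norm_bernoulliOneChar_eq_of_eq_eightyFour`.
* §4 **`eq_of_totient_le_twelve_mul_norm_bernoulliOneChar`**, **`mem_of_totient_le_six_mul_norm_bernoulliOneChar_of_odd`**,
  **`mem_of_totient_le_six_mul_norm_bernoulliOneChar_of_even`**, **`mem_of_totient_le_six_mul_norm_bernoulliOneChar`**.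

## Honest column

* No statement about class groups of number fields is made (the dictionary `|B_{1,χ_D}| = 2h(D)/w(D)` is the tree's
  `classNumber_mul_eq_neg_sum_mul_legendreSym` at prime level only); everything is about `B_{1,ψ}`.  HC_CM is NOT proved and nothing
  here bears on it.

## References

* [MontgomeryVaughan2007] H. L. Montgomery, R. C. Vaughan, *Multiplicative Number Theory I*, CUP 2007, §9.3 Thm. 9.13.
* [Oesterle1988Gauss] J. Oesterlé, Le problème de Gauss sur le nombre de classes, Enseign. Math. 34 (1988), II §3 (27).
* [IrelandRosen1982] K. Ireland, M. Rosen, GTM 84, Ch. 5 §1 Prop. 5.1.2; Ch. 8 Exercise 28; Ch. 15 §2.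
* [HardyWright2008] G. H. Hardy, E. M. Wright, *An Introduction to the Theory of Numbers*, 6th ed., §16.1–2 (Thm. 62), §18.4
  (Thms. 327–328), §22.
* [BauerCosteItzyksonRuelle1997] M. Bauer, A. Coste, C. Itzykson, P. Ruelle, J. Geom. Phys. 22 (1997), §3.4 (Koblitz's list [kob]).

## Provenance

Literature seat `lit-deligne-3` gen 45 of cell `pub-hodgecm2`.  HC_CM is NOT proved and nothing here bears on it.
-/

noncomputable section

open DirichletCharacter Finset
open scoped NumberTheorySymbols

namespace Literature.NumberTheory.LFunctions.PrimitiveQuadratic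

open QuadraticBernoulliCertificates BernoulliOneCharBound

/-! ## §1 Arithmetic and analytic helpers -/

section Arithmetic

/-- Every `q < 149` is `< 2`, even, one of the `33` odd primes `≤ 139`, or has a proper divisor among the primes `≤ 139`. [folklore] -/
private theorem small_cases : ∀ q ∈ Finset.range 149, q < 2 ∨ q % 2 = 0 ∨ q ∈ ([3, 5, 7, 11, 13, 17, 19, 23, 29, 31, 37, 41, 43, 47, 53,
    59, 61, 67, 71, 73, 79, 83, 89, 97, 101, 103, 107, 109, 113, 127, 131, 137, 139] : List ℕ) ∨
    ∃ d ∈ ([2, 3, 5, 7, 11, 13, 17, 19, 23, 29, 31, 37, 41, 43, 47, 53, 59, 61, 67, 71, 73, 79, 83, 89, 97, 101, 103, 107, 109, 113, 127,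
        131, 137, 139] : List ℕ), d < q ∧ d ∣ q := by
  decide +kernel

/-- The `33` listed odd numbers and the `34` listed numbers are primes; the first list has no repetition. [folklore] -/
private theorem sp_facts : (∀ p ∈ ([3, 5, 7, 11, 13, 17, 19, 23, 29, 31, 37, 41, 43, 47, 53, 59, 61, 67, 71, 73, 79, 83, 89, 97, 101,
    103, 107, 109, 113, 127, 131, 137, 139] : List ℕ), p.Prime) ∧
    (([3, 5, 7, 11, 13, 17, 19, 23, 29, 31, 37, 41, 43, 47, 53, 59, 61, 67, 71, 73, 79, 83, 89, 97, 101, 103, 107, 109, 113, 127, 131,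
        137, 139] : List ℕ)).Nodup ∧
    (∀ p ∈ ([2, 3, 5, 7, 11, 13, 17, 19, 23, 29, 31, 37, 41, 43, 47, 53, 59, 61, 67, 71, 73, 79, 83, 89, 97, 101, 103, 107, 109, 113,
        127, 131, 137, 139] : List ℕ), p.Prime) := by
  refine ⟨?_, by decide, ?_⟩
  · intro p hp
    simp only [List.mem_cons, List.mem_nil_iff, or_false] at hp
    rcases hp with rfl | rfl | rfl | rfl | rfl | rfl | rfl | rfl | rfl | rfl | rfl | rfl | rfl | rfl | rfl | rfl | rfl | rfl | rfl |
      rfl | rfl | rfl | rfl | rfl | rfl | rfl | rfl | rfl | rfl | rfl | rfl | rfl | rfl <;> norm_num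
  · intro p hp
    simp only [List.mem_cons, List.mem_nil_iff, or_false] at hp
    rcases hp with rfl | rfl | rfl | rfl | rfl | rfl | rfl | rfl | rfl | rfl | rfl | rfl | rfl | rfl | rfl | rfl | rfl | rfl | rfl |
      rfl | rfl | rfl | rfl | rfl | rfl | rfl | rfl | rfl | rfl | rfl | rfl | rfl | rfl | rfl <;> norm_num

/-- **Primality by trial division, as certified inside the kernel tables**: `1 < p < 149²` without a divisor `d`, `d² ≤ p`, among the
primes `≤ 139` is prime. [folklore] -/
private theorem prime_of_trialDivision {p : ℕ} (h1 : 1 < p) (hlt : p < 22201)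
    (h : ∀ d ∈ ([2, 3, 5, 7, 11, 13, 17, 19, 23, 29, 31, 37, 41, 43, 47, 53, 59, 61, 67, 71, 73, 79, 83, 89, 97, 101, 103, 107, 109, 113,
        127, 131, 137, 139] : List ℕ), d * d ≤ p → p % d ≠ 0) : p.Prime := by
  by_contra hp
  have hmf : p.minFac.Prime := Nat.minFac_prime h1.ne'
  have hdvd : p.minFac ∣ p := Nat.minFac_dvd p
  have hsq : p.minFac ^ 2 ≤ p := Nat.minFac_sq_le_self (by omega) hp
  have hm149 : p.minFac < 149 := by nlinarith
  have hmod : p % p.minFac = 0 := Nat.mod_eq_zero_of_dvd hdvd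
  rcases small_cases p.minFac (Finset.mem_range.2 hm149) with h2 | h2 | h2 | ⟨d, hd, hdlt, hddvd⟩
  · exact absurd hmf.two_le (by omega)
  · rcases (Nat.dvd_prime hmf).1 (Nat.dvd_of_mod_eq_zero h2) with h3 | h3
    · exact absurd h3 (by norm_num)
    · -- `minFac p = 2`
      rw [← h3] at hsq hmod
      exact h 2 (by simp) (by nlinarith) hmod
  · exact h _ (List.mem_cons_of_mem _ h2) (by nlinarith) hmod
  · have hdp : d.Prime := sp_facts.2.2 d hd
    rcases (Nat.dvd_prime hmf).1 hddvd with h3 | h3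
    · exact absurd hdp.two_le (by omega)
    · omega

/-- The totient of the product of a list of pairwise distinct primes is `∏(p − 1)`. [folklore] -/
private theorem totient_listProd_eq {ps : List ℕ} (hps : ∀ p ∈ ps, p.Prime) (hnd : ps.Nodup) :
    Nat.totient ps.prod = (ps.map fun p => p - 1).prod := by
  induction ps with
  | nil => simp
  | cons p ps ih =>
    have hp := hps p List.mem_cons_self
    obtain ⟨hnot, hnd'⟩ := List.nodup_cons.1 hnd
    have hrest : ∀ q ∈ ps, q.Prime := fun q hq => hps q (List.mem_cons_of_mem _ hq)
    have hcop : Nat.Coprime p ps.prod := by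
      rw [Nat.coprime_list_prod_right_iff]
      intro q hq
      exact (Nat.coprime_primes hp (hrest q hq)).2 fun h => hnot (h ▸ hq)
    rw [List.prod_cons, List.map_cons, List.prod_cons, Nat.totient_mul hcop, Nat.totient_prime hp, ih hrest hnd']

/-- A list of primes with squarefree product has no repetition. [folklore] -/
private theorem nodup_of_squarefree_listProd {ps : List ℕ} (hps : ∀ p ∈ ps, p.Prime) (hsq : Squarefree ps.prod) : ps.Nodup := by
  induction ps with
  | nil => simp
  | cons p ps ih =>
    rw [List.prod_cons] at hsq
    have hrest : ∀ q ∈ ps, q.Prime := fun q hq => hps q (List.mem_cons_of_mem _ hq)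
    refine List.nodup_cons.2 ⟨fun hmem => ?_, ih hrest (Squarefree.of_mul_right hsq)⟩
    have hdvd : p * p ∣ p * ps.prod := Nat.mul_dvd_mul_left p (List.dvd_prod hmem)
    exact (hps p List.mem_cons_self).ne_one (Nat.isUnit_iff.1 (hsq p hdvd))

/-- The product of a list of pairwise distinct primes each dividing `n` divides `n`. [folklore] -/
private theorem listProd_dvd {n : ℕ} {ps : List ℕ} (hps : ∀ p ∈ ps, p.Prime) (hnd : ps.Nodup) (hdvd : ∀ p ∈ ps, p ∣ n) :
    ps.prod ∣ n := by
  induction ps with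
  | nil => simp
  | cons p ps ih =>
    have hp := hps p List.mem_cons_self
    obtain ⟨hnot, hnd'⟩ := List.nodup_cons.1 hnd
    have hrest : ∀ q ∈ ps, q.Prime := fun q hq => hps q (List.mem_cons_of_mem _ hq)
    have hcop : Nat.Coprime p ps.prod := by
      rw [Nat.coprime_list_prod_right_iff]
      intro q hq
      exact (Nat.coprime_primes hp (hrest q hq)).2 fun h => hnot (h ▸ hq)
    rw [List.prod_cons]
    exact hcop.mul_dvd_of_dvd_of_dvd (hdvd p List.mem_cons_self) (ih hrest hnd' fun q hq => hdvd q (List.mem_cons_of_mem _ hq))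

/-- **THE TOTIENT OF AN ODD SQUAREFREE `n < 149²` BY TRIAL DIVISION** (the expression evaluated by the kernel sweeps): with `A` the list
of the odd primes `≤ 139` dividing `n` and `r = n/∏A` (which is `1` or a prime `≥ 149`), `φ(n) = ∏_{p∈A}(p − 1)·(r = 1 ? 1 : r − 1)`.
[cite: HardyWright2008, §16.1–2 Thm. 62 (φ is multiplicative, φ(p) = p − 1)] -/
theorem totient_eq_trialDivision {n : ℕ} (hn : Odd n) (hsq : Squarefree n) (hlt : n < 22201) :
    Nat.totient n =
      (((([3, 5, 7, 11, 13, 17, 19, 23, 29, 31, 37, 41, 43, 47, 53, 59, 61, 67, 71, 73, 79, 83, 89, 97, 101, 103, 107, 109, 113, 127,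
          131, 137, 139] : List ℕ).filter (· ∣ n)).map fun p => p - 1).prod *
          (if n / (([3, 5, 7, 11, 13, 17, 19, 23, 29, 31, 37, 41, 43, 47, 53, 59, 61, 67, 71, 73, 79, 83, 89, 97, 101, 103, 107, 109,
              113, 127, 131, 137, 139] : List ℕ).filter (· ∣ n)).prod = 1 then 1
           else n / (([3, 5, 7, 11, 13, 17, 19, 23, 29, 31, 37, 41, 43, 47, 53, 59, 61, 67, 71, 73, 79, 83, 89, 97, 101, 103, 107, 109,
               113, 127, 131, 137, 139] : List ℕ).filter (· ∣ n)).prod - 1)) := by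
  obtain ⟨hSPprime, hSPnodup, -⟩ := sp_facts
  set A := (([3, 5, 7, 11, 13, 17, 19, 23, 29, 31, 37, 41, 43, 47, 53, 59, 61, 67, 71, 73, 79, 83, 89, 97, 101, 103, 107, 109, 113, 127,
      131, 137, 139] : List ℕ)).filter (· ∣ n)
  have hn0 : n ≠ 0 := fun h => by simp [h] at hn
  have hAprime : ∀ p ∈ A, p.Prime := fun p hp => hSPprime p (List.mem_of_mem_filter hp)
  have hAdvd : ∀ p ∈ A, p ∣ n := fun p hp => by
    have := (List.mem_filter.1 hp).2
    simpa using this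
  have hAnodup : A.Nodup := hSPnodup.filter _
  have hgdvd : A.prod ∣ n := listProd_dvd hAprime hAnodup hAdvd
  obtain ⟨r, hr⟩ := hgdvd
  have hg0 : A.prod ≠ 0 := fun h => hn0 (by rw [hr, h, zero_mul])
  have hgpos : 0 < A.prod := Nat.pos_of_ne_zero hg0
  have hrdef : n / A.prod = r := by rw [hr, Nat.mul_div_cancel_left _ hgpos]
  rw [hrdef]
  have hsq' : Squarefree (A.prod * r) := hr ▸ hsq
  obtain ⟨hcop, -, -⟩ := Nat.squarefree_mul_iff.1 hsq'
  have hφ : Nat.totient n = (A.map fun p => p - 1).prod * Nat.totient r := by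
    rw [hr, Nat.totient_mul hcop, totient_listProd_eq hAprime hAnodup]
  rw [hφ]
  congr 1
  have hr0 : r ≠ 0 := fun h => hn0 (by rw [hr, h, mul_zero])
  have hrle : r ≤ n := by rw [hr]; exact Nat.le_mul_of_pos_left r hgpos
  -- every prime factor of `r` is `≥ 149`
  have hbig : ∀ q : ℕ, q.Prime → q ∣ r → 149 ≤ q := by
    intro q hq hqr
    by_contra hle'
    have hlt' : q < 149 := Nat.lt_of_not_le hle'
    have hqn : q ∣ n := by rw [hr]; exact Dvd.dvd.mul_left hqr _
    have hqodd : q % 2 = 1 := Nat.odd_iff.1 (hn.of_dvd_nat hqn)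
    rcases small_cases q (Finset.mem_range.2 hlt') with h | h | h | ⟨d, hd, hdlt, hddvd⟩
    · exact absurd hq.two_le (by omega)
    · omega
    · have hqA : q ∈ A := List.mem_filter.2 ⟨h, by simpa using hqn⟩
      have hqg : q ∣ A.prod := List.dvd_prod hqA
      exact hq.ne_one ((Nat.Coprime.coprime_dvd_left hqg hcop).eq_one_of_dvd hqr)
    · have hdp : d.Prime := sp_facts.2.2 d hd
      rcases (Nat.dvd_prime hq).1 hddvd with h3 | h3
      · exact absurd hdp.two_le (by omega)
      · omega
  by_cases hr1 : r = 1
  · rw [if_pos hr1, hr1, Nat.totient_one]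
  · rw [if_neg hr1]
    have hrprime : r.Prime := by
      by_contra hnp
      have hmf : r.minFac.Prime := Nat.minFac_prime hr1
      have h149 : 149 ≤ r.minFac := hbig _ hmf (Nat.minFac_dvd r)
      have hsqle : r.minFac ^ 2 ≤ r := Nat.minFac_sq_le_self (Nat.pos_of_ne_zero hr0) hnp
      nlinarith
    rw [Nat.totient_prime hrprime]

/-- `2 log f ≤ k` once `f ≤ t` and `t²·10^{9k} ≤ 2718281828^k` (an integer form of `t² ≤ e^k`, `e > 2.718281828`). [folklore] -/
private theorem two_mul_log_le_of_le {f t k : ℕ} (hf : 0 < f) (hft : f ≤ t) (hnum : t ^ 2 * 10 ^ (9 * k) ≤ 2718281828 ^ k) :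
    2 * Real.log f ≤ (k : ℝ) := by
  have hfR : (0 : ℝ) < f := by exact_mod_cast hf
  have he : (2718281828 : ℝ) / 10 ^ 9 ≤ Real.exp 1 := le_trans (by norm_num) Real.exp_one_gt_d9.le
  have hpos : (0 : ℝ) < (10 : ℝ) ^ (9 * k) := by positivity
  have h1 : ((t : ℝ)) ^ 2 * (10 : ℝ) ^ (9 * k) ≤ (2718281828 : ℝ) ^ k := by exact_mod_cast hnum
  have h2 : ((t : ℝ)) ^ 2 ≤ ((2718281828 : ℝ) / 10 ^ 9) ^ k := by
    rw [div_pow, ← pow_mul, le_div_iff₀ hpos]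
    exact h1
  have h3 : ((2718281828 : ℝ) / 10 ^ 9) ^ k ≤ Real.exp k := by
    rw [← Real.exp_one_pow]
    exact pow_le_pow_left₀ (by positivity) he k
  have hf2 : (f : ℝ) ^ 2 ≤ Real.exp k := by
    have : ((f : ℝ)) ^ 2 ≤ (t : ℝ) ^ 2 := by gcongr
    linarith
  have h := Real.log_le_log (by positivity) hf2
  rw [Real.log_pow, Real.log_exp] at h
  exact_mod_cast h

/-- **`2 log f ≤ L(f)`** for the table `L` of the kernel sweeps (`f ≤ ⌊e^{L/2}⌋`), valid for `f < 22027`. [folklore] -/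
private theorem two_mul_log_le_table {f : ℕ} (hf : 0 < f) (hlt : f < 22027) :
    2 * Real.log f ≤
      (((if f < 91 then 9 else if f < 149 then 10 else if f < 245 then 11 else 
          if f < 404 then 12 else if f < 666 then 13 else if f < 1097 then 14 else 
          if f < 1809 then 15 else if f < 2981 then 16 else if f < 4915 then 17 else 
          if f < 8104 then 18 else if f < 13360 then 19 else 20) : ℕ) : ℝ) := by
  by_cases h9 : f < 91
  · rw [if_pos h9]; exact two_mul_log_le_of_le (t := 90) (k := 9) hf (by omega) (by norm_num)
  rw [if_neg h9]
  by_cases h10 : f < 149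
  · rw [if_pos h10]; exact two_mul_log_le_of_le (t := 148) (k := 10) hf (by omega) (by norm_num)
  rw [if_neg h10]
  by_cases h11 : f < 245
  · rw [if_pos h11]; exact two_mul_log_le_of_le (t := 244) (k := 11) hf (by omega) (by norm_num)
  rw [if_neg h11]
  by_cases h12 : f < 404
  · rw [if_pos h12]; exact two_mul_log_le_of_le (t := 403) (k := 12) hf (by omega) (by norm_num)
  rw [if_neg h12]
  by_cases h13 : f < 666
  · rw [if_pos h13]; exact two_mul_log_le_of_le (t := 665) (k := 13) hf (by omega) (by norm_num)
  rw [if_neg h13]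
  by_cases h14 : f < 1097
  · rw [if_pos h14]; exact two_mul_log_le_of_le (t := 1096) (k := 14) hf (by omega) (by norm_num)
  rw [if_neg h14]
  by_cases h15 : f < 1809
  · rw [if_pos h15]; exact two_mul_log_le_of_le (t := 1808) (k := 15) hf (by omega) (by norm_num)
  rw [if_neg h15]
  by_cases h16 : f < 2981
  · rw [if_pos h16]; exact two_mul_log_le_of_le (t := 2980) (k := 16) hf (by omega) (by norm_num)
  rw [if_neg h16]
  by_cases h17 : f < 4915
  · rw [if_pos h17]; exact two_mul_log_le_of_le (t := 4914) (k := 17) hf (by omega) (by norm_num)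
  rw [if_neg h17]
  by_cases h18 : f < 8104
  · rw [if_pos h18]; exact two_mul_log_le_of_le (t := 8103) (k := 18) hf (by omega) (by norm_num)
  rw [if_neg h18]
  by_cases h19 : f < 13360
  · rw [if_pos h19]; exact two_mul_log_le_of_le (t := 13359) (k := 19) hf (by omega) (by norm_num)
  rw [if_neg h19]
  exact two_mul_log_le_of_le (t := 22026) (k := 20) hf (by omega) (by norm_num)

/-- From the integer criterion `(M²/4)·10⁴·f·L² < 98696·P²` with `2 log f ≤ L` and `P ≤ φ(f)`: `M·π⁻¹·√f·log f < φ(f)` (`π² > 9.8696`).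
[folklore] -/
private theorem mul_lt_totient_of_crit {M : ℝ} {c f L P : ℕ} (hM : 0 < M) (hMc : M ^ 2 * 2500 = (c : ℝ)) (hf : 0 < f)
    (hlog : 2 * Real.log f ≤ (L : ℝ)) (hP : (P : ℝ) ≤ (Nat.totient f : ℝ)) (h : c * f * L ^ 2 < 98696 * P ^ 2) :
    M * (Real.pi⁻¹ * Real.sqrt f * Real.log f) < (Nat.totient f : ℝ) := by
  have hfR : (0 : ℝ) < f := by exact_mod_cast hf
  have hf1 : (1 : ℝ) ≤ f := by exact_mod_cast Nat.succ_le_of_lt hf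
  have hπ := Real.pi_gt_d6
  have hπpos := Real.pi_pos
  have hπne : Real.pi ≠ 0 := Real.pi_ne_zero
  have hsqrt : 0 < Real.sqrt f := Real.sqrt_pos.2 hfR
  have hsq : Real.sqrt f ^ 2 = f := Real.sq_sqrt hfR.le
  have hlog0 : 0 ≤ Real.log f := Real.log_nonneg hf1
  have hL0 : (0 : ℝ) ≤ L := by linarith
  have hP0 : (0 : ℝ) ≤ P := Nat.cast_nonneg _
  have hφ0 : (0 : ℝ) ≤ (Nat.totient f : ℝ) := Nat.cast_nonneg _
  have hR : (c : ℝ) * f * (L : ℝ) ^ 2 < 98696 * (P : ℝ) ^ 2 := by exact_mod_cast h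
  have hπ2 : (98696 : ℝ) ≤ 10000 * Real.pi ^ 2 := by nlinarith
  have key : (M / 2 * Real.sqrt f * L) ^ 2 < (Real.pi * (Nat.totient f : ℝ)) ^ 2 := by
    have e1 : (M / 2 * Real.sqrt f * L) ^ 2 = (M ^ 2 * 2500) * f * (L : ℝ) ^ 2 / 10000 := by
      rw [mul_pow, mul_pow, hsq]; ring
    rw [e1, hMc, div_lt_iff₀ (by norm_num : (0 : ℝ) < 10000)]
    have h2 : (P : ℝ) ^ 2 ≤ (Nat.totient f : ℝ) ^ 2 := by gcongr
    nlinarith [mul_le_mul_of_nonneg_right hπ2 (sq_nonneg (Nat.totient f : ℝ))]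
  have key' : M / 2 * Real.sqrt f * L < Real.pi * (Nat.totient f : ℝ) :=
    lt_of_pow_lt_pow_left₀ 2 (by positivity) key
  have hll : M * (Real.pi⁻¹ * Real.sqrt f * Real.log f) ≤ Real.pi⁻¹ * (M / 2 * Real.sqrt f * L) := by
    have h1 : Real.sqrt f * Real.log f ≤ Real.sqrt f * ((L : ℝ) / 2) := mul_le_mul_of_nonneg_left (by linarith) hsqrt.le
    have e : Real.pi⁻¹ * (M / 2 * Real.sqrt f * L) = M * (Real.pi⁻¹ * (Real.sqrt f * ((L : ℝ) / 2))) := by ring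
    rw [e, show M * (Real.pi⁻¹ * Real.sqrt f * Real.log f) = M * (Real.pi⁻¹ * (Real.sqrt f * Real.log f)) by ring]
    exact mul_le_mul_of_nonneg_left (mul_le_mul_of_nonneg_left h1 (inv_nonneg.2 hπpos.le)) hM.le
  calc M * (Real.pi⁻¹ * Real.sqrt f * Real.log f) ≤ Real.pi⁻¹ * (M / 2 * Real.sqrt f * L) := hll
    _ < Real.pi⁻¹ * (Real.pi * (Nat.totient f : ℝ)) := mul_lt_mul_of_pos_left key' (inv_pos.2 hπpos)
    _ = (Nat.totient f : ℝ) := by field_simp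

/-- `M = 12`: `36·10⁴·f·L² < 98696·P²`, `2 log f ≤ L`, `P ≤ φ(f)` ⟹ `12π⁻¹√f log f < φ(f)`. [folklore] -/
private theorem twelve_mul_lt_totient_of_crit {f L P : ℕ} (hf : 0 < f) (hlog : 2 * Real.log f ≤ (L : ℝ))
    (hP : (P : ℝ) ≤ (Nat.totient f : ℝ)) (h : 360000 * f * L ^ 2 < 98696 * P ^ 2) :
    12 * (Real.pi⁻¹ * Real.sqrt f * Real.log f) < (Nat.totient f : ℝ) :=
  mul_lt_totient_of_crit (by norm_num) (by norm_num) hf hlog hP h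

/-- `M = 6`: `9·10⁴·f·L² < 98696·P²`, `2 log f ≤ L`, `P ≤ φ(f)` ⟹ `6π⁻¹√f log f < φ(f)`. [folklore] -/
private theorem six_mul_lt_totient_of_crit {f L P : ℕ} (hf : 0 < f) (hlog : 2 * Real.log f ≤ (L : ℝ))
    (hP : (P : ℝ) ≤ (Nat.totient f : ℝ)) (h : 90000 * f * L ^ 2 < 98696 * P ^ 2) :
    6 * (Real.pi⁻¹ * Real.sqrt f * Real.log f) < (Nat.totient f : ℝ) :=
  mul_lt_totient_of_crit (by norm_num) (by norm_num) hf hlog hP h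

/-- For a finite set `s` of integers `≥ 2`: `∏_{x∈s} x ≤ (|s| + 1)·∏_{x∈s}(x − 1)` (the `i`-th smallest element is `≥ i + 1`).
[folklore] -/
private theorem prod_le_card_succ_mul_prod_sub_one' (s : Finset ℕ) (hs : ∀ x ∈ s, 2 ≤ x) :
    ∏ x ∈ s, x ≤ (s.card + 1) * ∏ x ∈ s, (x - 1) := by
  classical
  induction s using Finset.induction_on_max with
  | empty => simp
  | insert a s hlt ih =>
    have ha : a ∉ s := fun h => lt_irrefl a (hlt a h)
    have hs' : ∀ x ∈ s, 2 ≤ x := fun x hx => hs x (Finset.mem_insert_of_mem hx)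
    have hcard : s.card + 2 ≤ a := by
      have ha2 : 2 ≤ a := hs a (Finset.mem_insert_self a s)
      have hsub : s ⊆ Finset.Ico 2 a := fun x hx => Finset.mem_Ico.2 ⟨hs' x hx, hlt x hx⟩
      have h := Finset.card_le_card hsub
      rw [Nat.card_Ico] at h
      omega
    obtain ⟨b, rfl⟩ : ∃ b, a = b + 2 := ⟨a - 2, by omega⟩
    rw [Finset.prod_insert ha, Finset.prod_insert ha, Finset.card_insert_of_notMem ha, show b + 2 - 1 = b + 1 by omega]
    have ih' := ih hs'
    calc (b + 2) * ∏ x ∈ s, x ≤ (b + 2) * ((s.card + 1) * ∏ x ∈ s, (x - 1)) := Nat.mul_le_mul_left _ ih'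
      _ = ((b + 2) * (s.card + 1)) * ∏ x ∈ s, (x - 1) := by ring
      _ ≤ ((s.card + 1 + 1) * (b + 1)) * ∏ x ∈ s, (x - 1) := by
          apply Nat.mul_le_mul_right
          nlinarith [hcard]
      _ = (s.card + 1 + 1) * ((b + 1) * ∏ x ∈ s, (x - 1)) := by ring

/-- `n ≤ φ(n)·(⌊log₂ n⌋ + 1)` for `n ≠ 0` (a crude form of Hardy–Wright Thm. 328). [folklore] -/
private theorem le_totient_mul_log_two_succ' (n : ℕ) (hn : n ≠ 0) : n ≤ n.totient * (Nat.log 2 n + 1) := by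
  have hkey := Nat.totient_mul_prod_primeFactors n
  have hP := prod_le_card_succ_mul_prod_sub_one' n.primeFactors fun p hp => (Nat.prime_of_mem_primeFactors hp).two_le
  have hω : n.primeFactors.card ≤ Nat.log 2 n := by
    have h2 : 2 ^ n.primeFactors.card ≤ ∏ p ∈ n.primeFactors, p := by
      rw [← Finset.prod_const]
      exact Finset.prod_le_prod' fun p hp => (Nat.prime_of_mem_primeFactors hp).two_le
    have h3 : ∏ p ∈ n.primeFactors, p ≤ n := Nat.le_of_dvd (Nat.pos_of_ne_zero hn) (Nat.prod_primeFactors_dvd n)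
    exact Nat.le_log_of_pow_le (by norm_num) (h2.trans h3)
  have hpos : 0 < ∏ p ∈ n.primeFactors, (p - 1) :=
    Finset.prod_pos fun p hp => by have := (Nat.prime_of_mem_primeFactors hp).two_le; omega
  have h1 : n * ∏ p ∈ n.primeFactors, (p - 1) ≤ (n.totient * (n.primeFactors.card + 1)) * ∏ p ∈ n.primeFactors, (p - 1) := by
    calc n * ∏ p ∈ n.primeFactors, (p - 1) = n.totient * ∏ p ∈ n.primeFactors, p := hkey.symm
      _ ≤ n.totient * ((n.primeFactors.card + 1) * ∏ p ∈ n.primeFactors, (p - 1)) := Nat.mul_le_mul_left _ hP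
      _ = (n.totient * (n.primeFactors.card + 1)) * ∏ p ∈ n.primeFactors, (p - 1) := by ring
  have h2 := Nat.le_of_mul_le_mul_right h1 hpos
  calc n ≤ n.totient * (n.primeFactors.card + 1) := h2
    _ ≤ n.totient * (Nat.log 2 n + 1) := Nat.mul_le_mul_left _ (by omega)

/-- `8·(L + 1)⁴ ≤ 2^L` for `L ≥ 21`. [folklore] -/
private theorem eight_mul_pow_four_le_two_pow' {L : ℕ} (hL : 21 ≤ L) : 8 * (L + 1) ^ 4 ≤ 2 ^ L := by
  induction L, hL using Nat.le_induction with
  | base => norm_num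
  | succ n hn ih =>
    have h22 : 22 * (n + 2) ≤ 23 * (n + 1) := by omega
    have h4 : (22 * (n + 2)) ^ 4 ≤ (23 * (n + 1)) ^ 4 := Nat.pow_le_pow_left h22 4
    have hstep : 22 ^ 4 * (n + 2) ^ 4 ≤ 22 ^ 4 * (2 * (n + 1) ^ 4) := by
      calc 22 ^ 4 * (n + 2) ^ 4 = (22 * (n + 2)) ^ 4 := by ring
        _ ≤ (23 * (n + 1)) ^ 4 := h4
        _ = 23 ^ 4 * (n + 1) ^ 4 := by ring
        _ ≤ (2 * 22 ^ 4) * (n + 1) ^ 4 := Nat.mul_le_mul_right _ (by norm_num)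
        _ = 22 ^ 4 * (2 * (n + 1) ^ 4) := by ring
    have hstep' : (n + 2) ^ 4 ≤ 2 * (n + 1) ^ 4 := Nat.le_of_mul_le_mul_left hstep (by norm_num)
    calc 8 * (n + 1 + 1) ^ 4 = 8 * (n + 2) ^ 4 := by ring
      _ ≤ 8 * (2 * (n + 1) ^ 4) := Nat.mul_le_mul_left _ hstep'
      _ = 2 * (8 * (n + 1) ^ 4) := by ring
      _ ≤ 2 * 2 ^ n := Nat.mul_le_mul_left _ ih
      _ = 2 ^ (n + 1) := by ring

/-- **`φ(f) ≤ (12/π)√f·log f` forces `f < 2²¹`** (`f ≤ φ(f)(⌊log₂f⌋ + 1)`, `log f < (⌊log₂f⌋ + 1) log 2`, `12 log 2/π < 2.78`,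
`8(L+1)⁴ ≤ 2^L` for `L ≥ 21`; the argument of the Koblitz-list file `…KoblitzListConductorFinite`, freed from the group triple).
[cite: HardyWright2008, §18.4 Thm. 328] [cite: Oesterle1988Gauss, II §3 (27)] -/
theorem lt_two_pow_of_totient_le {f : ℕ} (hf2 : 2 ≤ f)
    (hA : (Nat.totient f : ℝ) ≤ 12 * (Real.pi⁻¹ * Real.sqrt f * Real.log f)) : f < 2 ^ 21 := by
  have hf0 : f ≠ 0 := by omega
  have hB := le_totient_mul_log_two_succ' f hf0
  set L := Nat.log 2 f with hL
  by_contra hge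
  push Not at hge
  have hL21 : 21 ≤ L := Nat.le_log_of_pow_le (by norm_num) hge
  have h2L : 2 ^ L ≤ f := Nat.pow_log_le_self 2 hf0
  have hlt : f < 2 ^ (L + 1) := Nat.lt_pow_succ_log_self (by norm_num) f
  have h8 := eight_mul_pow_four_le_two_pow' hL21
  have hfR : (0 : ℝ) < f := by exact_mod_cast Nat.pos_of_ne_zero hf0
  have hf2R : (1 : ℝ) < f := by exact_mod_cast hf2
  have hlog2 := Real.log_two_lt_d9
  have hlog2pos : 0 < Real.log 2 := Real.log_pos (by norm_num)
  have hpi := Real.pi_gt_three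
  have hπinv : Real.pi⁻¹ < 1 / 3 := by
    rw [inv_eq_one_div]
    exact one_div_lt_one_div_of_lt (by norm_num) hpi
  have hπinv_pos : 0 < Real.pi⁻¹ := inv_pos.2 Real.pi_pos
  have hlogf : Real.log f < ((L : ℝ) + 1) * Real.log 2 := by
    have h' : (f : ℝ) < (2 : ℝ) ^ (L + 1) := by exact_mod_cast hlt
    calc Real.log f < Real.log ((2 : ℝ) ^ (L + 1)) := Real.log_lt_log hfR h'
      _ = ((L : ℝ) + 1) * Real.log 2 := by rw [Real.log_pow]; push_cast; ring
  have hlogf_pos : 0 < Real.log f := Real.log_pos hf2R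
  have hsqrt_pos : 0 < Real.sqrt f := Real.sqrt_pos.2 hfR
  have hBR : (f : ℝ) ≤ (f.totient : ℝ) * ((L : ℝ) + 1) := by exact_mod_cast hB
  have hL1 : (0 : ℝ) < (L : ℝ) + 1 := by positivity
  have hconst : 12 * (Real.pi⁻¹ * Real.log 2) < 2.78 := by
    nlinarith [mul_pos (sub_pos.2 hπinv) hlog2pos, mul_pos (sub_pos.2 hlog2) (show (0 : ℝ) < 1 / 3 by norm_num)]
  have hstep1 : (f : ℝ) ≤ 12 * (Real.pi⁻¹ * Real.sqrt f * Real.log f) * ((L : ℝ) + 1) := by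
    calc (f : ℝ) ≤ (f.totient : ℝ) * ((L : ℝ) + 1) := hBR
      _ ≤ 12 * (Real.pi⁻¹ * Real.sqrt f * Real.log f) * ((L : ℝ) + 1) := mul_le_mul_of_nonneg_right hA hL1.le
  have hstep2 : 12 * (Real.pi⁻¹ * Real.sqrt f * Real.log f) * ((L : ℝ) + 1) <
      12 * (Real.pi⁻¹ * Real.sqrt f * (((L : ℝ) + 1) * Real.log 2)) * ((L : ℝ) + 1) := by
    have hc : 0 < 12 * (Real.pi⁻¹ * Real.sqrt f) * ((L : ℝ) + 1) := by positivity
    nlinarith [mul_lt_mul_of_pos_left hlogf hc]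
  have hstep3 : 12 * (Real.pi⁻¹ * Real.sqrt f * (((L : ℝ) + 1) * Real.log 2)) * ((L : ℝ) + 1) ≤
      2.78 * Real.sqrt f * ((L : ℝ) + 1) ^ 2 := by
    have e : 12 * (Real.pi⁻¹ * Real.sqrt f * (((L : ℝ) + 1) * Real.log 2)) * ((L : ℝ) + 1) =
        (12 * (Real.pi⁻¹ * Real.log 2)) * (Real.sqrt f * ((L : ℝ) + 1) ^ 2) := by ring
    rw [e, show 2.78 * Real.sqrt f * ((L : ℝ) + 1) ^ 2 = 2.78 * (Real.sqrt f * ((L : ℝ) + 1) ^ 2) by ring]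
    exact mul_le_mul_of_nonneg_right hconst.le (by positivity)
  have hsq : Real.sqrt f * Real.sqrt f < 2.78 * ((L : ℝ) + 1) ^ 2 * Real.sqrt f := by
    rw [Real.mul_self_sqrt hfR.le]
    calc (f : ℝ) < 2.78 * Real.sqrt f * ((L : ℝ) + 1) ^ 2 := by linarith
      _ = 2.78 * ((L : ℝ) + 1) ^ 2 * Real.sqrt f := by ring
  have hroot : Real.sqrt f < 2.78 * ((L : ℝ) + 1) ^ 2 := lt_of_mul_lt_mul_right hsq hsqrt_pos.le
  have hf4 : (f : ℝ) < (2.78 * ((L : ℝ) + 1) ^ 2) * (2.78 * ((L : ℝ) + 1) ^ 2) := by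
    rw [← Real.mul_self_sqrt hfR.le]
    exact mul_lt_mul'' hroot hroot hsqrt_pos.le hsqrt_pos.le
  have h8R : (8 : ℝ) * ((L : ℝ) + 1) ^ 4 ≤ (2 : ℝ) ^ L := by exact_mod_cast h8
  have h2LR : (2 : ℝ) ^ L ≤ f := by exact_mod_cast h2L
  have hL4 : (0 : ℝ) < ((L : ℝ) + 1) ^ 4 := by positivity
  nlinarith

/-- An odd prime `≤ 17` is one of `3, 5, 7, 11, 13, 17`. [folklore] -/
private theorem mem_of_prime_le_seventeen {p : ℕ} (hp : p.Prime) (hp2 : p ≠ 2) (hle : p ≤ 17) :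
    p ∈ ({3, 5, 7, 11, 13, 17} : Finset ℕ) := by
  interval_cases p <;> first | (exfalso; revert hp; decide) | (exfalso; exact hp2 rfl) | decide

/-- **`φ(m) ≥ 0.2908·m` for odd squarefree `m < 19⁵`**: `φ(m)/m = ∏_{p∣m}(1 − 1/p)`; the primes `≤ 17` contribute at least
`∏_{3≤p≤17}(1 − 1/p) = 92160/255255`, and there are at most four primes `≥ 19` (`19⁵ > m`), each contributing `≥ 18/19`.
[cite: HardyWright2008, §18.4 Thms. 327–328] -/
theorem totient_ge_of_odd_squarefree {m : ℕ} (hm : Odd m) (hsq : Squarefree m) (hlt : m < 19 ^ 5) :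
    (0.2908 : ℝ) * m ≤ (Nat.totient m : ℝ) := by
  classical
  have hm0 : m ≠ 0 := fun h => by simp [h] at hm
  set P := m.primeFactors
  set g : ℕ → ℝ := fun p => ((p : ℝ) - 1) / p with hg
  have hprodP : ∏ p ∈ P, p = m := Nat.prod_primeFactors_of_squarefree hsq
  have hPprime : ∀ p ∈ P, p.Prime := fun p hp => Nat.prime_of_mem_primeFactors hp
  have hPodd : ∀ p ∈ P, p ≠ 2 := by
    intro p hp h2
    have : 2 ∣ m := h2 ▸ Nat.dvd_of_mem_primeFactors hp
    exact (Nat.not_even_iff_odd.2 hm) (even_iff_two_dvd.2 this)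
  -- `φ(m) = m · ∏ g`
  have hφ : (Nat.totient m : ℝ) = (m : ℝ) * ∏ p ∈ P, g p := by
    have h := Nat.totient_mul_prod_primeFactors m
    rw [hprodP] at h
    have h' : ((Nat.totient m : ℕ) : ℝ) * m = m * ∏ p ∈ P, ((p - 1 : ℕ) : ℝ) := by exact_mod_cast h
    have hm' : (m : ℝ) = ∏ p ∈ P, (p : ℝ) := by rw [← Nat.cast_prod, hprodP]
    have hsub : ∏ p ∈ P, ((p - 1 : ℕ) : ℝ) = ∏ p ∈ P, ((p : ℝ) - 1) :=
      Finset.prod_congr rfl fun p hp => by rw [Nat.cast_sub (hPprime p hp).one_le, Nat.cast_one]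
    have hgp : ∏ p ∈ P, g p = (∏ p ∈ P, ((p : ℝ) - 1)) / ∏ p ∈ P, (p : ℝ) := by
      simp only [hg]
      rw [Finset.prod_div_distrib]
    have hmR : (m : ℝ) ≠ 0 := by exact_mod_cast hm0
    have hφ' : (Nat.totient m : ℝ) = ∏ p ∈ P, ((p : ℝ) - 1) := by
      refine mul_left_cancel₀ hmR ?_
      rw [← hsub, ← h', mul_comm]
    have hmg : (m : ℝ) * ∏ p ∈ P, g p = ∏ p ∈ P, ((p : ℝ) - 1) := by
      rw [hgp, ← hm', mul_div_cancel₀ _ hmR]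
    rw [hφ', hmg]
  -- split the product at `17`
  have hsplit := Finset.prod_filter_mul_prod_filter_not P (fun p => p ≤ 17) g
  set S := P.filter (fun p => p ≤ 17)
  set B := P.filter (fun p => ¬p ≤ 17)
  have hg01 : ∀ p ∈ P, 0 < g p ∧ g p ≤ 1 := by
    intro p hp
    have h2 : (2 : ℝ) ≤ p := by exact_mod_cast (hPprime p hp).two_le
    refine ⟨div_pos (by linarith) (by linarith), (div_le_one (by linarith)).2 (by linarith)⟩
  -- the small primes
  have hT : ∏ p ∈ ({3, 5, 7, 11, 13, 17} : Finset ℕ), g p = 92160 / 255255 := by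
    simp only [hg]
    rw [Finset.prod_insert (by decide), Finset.prod_insert (by decide), Finset.prod_insert (by decide), Finset.prod_insert (by decide),
      Finset.prod_insert (by decide), Finset.prod_singleton]
    norm_num
  have hSsub : S ⊆ ({3, 5, 7, 11, 13, 17} : Finset ℕ) := by
    intro p hp
    obtain ⟨hpP, hp17⟩ := Finset.mem_filter.1 hp
    exact mem_of_prime_le_seventeen (hPprime p hpP) (hPodd p hpP) hp17
  have hSge : (92160 / 255255 : ℝ) ≤ ∏ p ∈ S, g p := by
    rw [← hT, ← Finset.prod_sdiff hSsub]
    have h1 : ∏ p ∈ ({3, 5, 7, 11, 13, 17} : Finset ℕ) \ S, g p ≤ 1 := by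
      refine Finset.prod_le_one (fun p hp => ?_) (fun p hp => ?_)
      · have hp' := (Finset.mem_sdiff.1 hp).1
        have h3 : (3 : ℝ) ≤ p := by
          simp only [Finset.mem_insert, Finset.mem_singleton] at hp'
          rcases hp' with rfl | rfl | rfl | rfl | rfl | rfl <;> norm_num
        exact (div_pos (by linarith) (by linarith)).le
      · have hp' := (Finset.mem_sdiff.1 hp).1
        have h3 : (3 : ℝ) ≤ p := by
          simp only [Finset.mem_insert, Finset.mem_singleton] at hp'
          rcases hp' with rfl | rfl | rfl | rfl | rfl | rfl <;> norm_num
        exact (div_le_one (by linarith)).2 (by linarith)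
    have h0 : 0 ≤ ∏ p ∈ S, g p := Finset.prod_nonneg fun p hp => (hg01 p (Finset.mem_filter.1 hp).1).1.le
    nlinarith
  -- the large primes: at most four, each factor `≥ 18/19`
  have hBcard : B.card ≤ 4 := by
    have h19 : 19 ^ B.card ≤ ∏ p ∈ B, p := by
      refine Finset.pow_card_le_prod B (fun p => p) 19 fun p hp => ?_
      obtain ⟨hpP, hp17⟩ := Finset.mem_filter.1 hp
      have hp18 : p ≠ 18 := fun h => by have := hPprime p hpP; rw [h] at this; exact absurd this (by norm_num)
      omega
    have hBP : ∏ p ∈ B, p ≤ ∏ p ∈ P, p :=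
      Finset.prod_le_prod_of_subset_of_one_le' (Finset.filter_subset _ _) fun p hp _ => (hPprime p hp).one_le
    rw [hprodP] at hBP
    have : 19 ^ B.card < 19 ^ 5 := lt_of_le_of_lt (h19.trans hBP) hlt
    have := (pow_lt_pow_iff_right₀ (by norm_num : (1 : ℕ) < 19)).1 this
    omega
  have hBge : ((18 : ℝ) / 19) ^ 4 ≤ ∏ p ∈ B, g p := by
    have h1 : ((18 : ℝ) / 19) ^ B.card ≤ ∏ p ∈ B, g p := by
      rw [← Finset.prod_const]
      refine Finset.prod_le_prod (fun _ _ => by norm_num) fun p hp => ?_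
      obtain ⟨hpP, hp17⟩ := Finset.mem_filter.1 hp
      have hp18 : p ≠ 18 := fun h => by have := hPprime p hpP; rw [h] at this; exact absurd this (by norm_num)
      have h19 : (19 : ℝ) ≤ p := by exact_mod_cast (by omega : 19 ≤ p)
      simp only [hg]
      rw [div_le_div_iff₀ (by norm_num) (by linarith)]
      nlinarith
    exact le_trans (pow_le_pow_of_le_one (by norm_num) (by norm_num) hBcard) h1
  have hBpos : 0 ≤ ∏ p ∈ B, g p := Finset.prod_nonneg fun p hp => (hg01 p (Finset.mem_filter.1 hp).1).1.le
  have hR : (0.2908 : ℝ) ≤ ∏ p ∈ P, g p := by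
    rw [← hsplit]
    calc (0.2908 : ℝ) ≤ (92160 / 255255) * ((18 : ℝ) / 19) ^ 4 := by norm_num
      _ ≤ (∏ p ∈ S, g p) * ∏ p ∈ B, g p := mul_le_mul hSge hBge (by positivity) (le_trans (by norm_num) hSge)
  rw [hφ]
  have hmnn : (0 : ℝ) ≤ m := Nat.cast_nonneg _
  nlinarith [mul_le_mul_of_nonneg_left hR hmnn]

/-- Tangent-line bound for the concave logarithm: `log x ≤ log x₀ + x/x₀ − 1`. [folklore] -/
private theorem log_le_log_add_div_sub_one' {x x₀ : ℝ} (hx : 0 < x) (hx₀ : 0 < x₀) :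
    Real.log x ≤ Real.log x₀ + x / x₀ - 1 := by
  have h := Real.log_le_sub_one_of_pos (div_pos hx hx₀)
  rw [Real.log_div hx.ne' hx₀.ne'] at h
  linarith

/-- **No `f ≥ 2·10⁴` has `0.2908·f ≤ (12/π)√f·log f`** (`x = √f ≥ 141.4`; `log x ≤ log 128 + x/128 − 1`; `24x log x < 0.2908πx²` for
`x > 127.4`). [cite: Oesterle1988Gauss, II §3 (27)] -/
theorem not_le_twelve_mul_of_le {f : ℕ} (hf : 20000 ≤ f) :
    ¬((0.2908 : ℝ) * f ≤ 12 * (Real.pi⁻¹ * Real.sqrt f * Real.log f)) := by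
  intro h
  have hfR : (20000 : ℝ) ≤ f := by exact_mod_cast hf
  have hf0 : (0 : ℝ) < f := by linarith
  set x := Real.sqrt f with hx
  have hx2 : x ^ 2 = f := Real.sq_sqrt hf0.le
  have hx141 : (141.4 : ℝ) ≤ x := by
    have h1 : Real.sqrt ((141.4 : ℝ) ^ 2) ≤ Real.sqrt f := Real.sqrt_le_sqrt (by nlinarith)
    rwa [Real.sqrt_sq (by norm_num)] at h1
  have hx0 : 0 < x := by linarith
  have hlogf : Real.log f = 2 * Real.log x := by
    rw [← hx2, Real.log_pow]; norm_num
  have hl := log_le_log_add_div_sub_one' hx0 (by norm_num : (0 : ℝ) < 128)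
  have h128 : Real.log 128 < 4.8520303 := by
    rw [show (128 : ℝ) = 2 ^ 7 by norm_num, Real.log_pow]
    have := Real.log_two_lt_d9
    push_cast
    linarith
  have hπ := Real.pi_gt_d6
  have hπpos := Real.pi_pos
  have hπne : Real.pi ≠ 0 := Real.pi_ne_zero
  rw [hlogf] at h
  have h1 : (0.2908 : ℝ) * f * Real.pi ≤ 12 * (Real.pi⁻¹ * x * (2 * Real.log x)) * Real.pi :=
    mul_le_mul_of_nonneg_right h hπpos.le
  rw [show 12 * (Real.pi⁻¹ * x * (2 * Real.log x)) * Real.pi = 24 * x * Real.log x by field_simp; ring, ← hx2] at h1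
  have h2 : 24 * x * Real.log x ≤ 24 * x * (3.8520303 + x / 128) := by
    have := mul_le_mul_of_nonneg_left (show Real.log x ≤ 3.8520303 + x / 128 by linarith) (by positivity : (0 : ℝ) ≤ 24 * x)
    linarith
  have h3 : (0.2908 : ℝ) * x ^ 2 * 3.141592 < 0.2908 * x ^ 2 * Real.pi := by
    have : (0 : ℝ) < 0.2908 * x ^ 2 := by positivity
    nlinarith
  nlinarith [mul_nonneg hx0.le (sub_nonneg.2 hx141)]

end Arithmetic

/-! ## §2 Even conductors: `ψ(b + f/2) = −ψ(b)` and `|B_{1,ψ}| = |Σ_{b<f/2} ψ(b)|/2` -/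

section EvenHalf

variable {f : ℕ} [NeZero f] {ψ : DirichletCharacter ℂ f}

/-- **`ψ(1 + f/2) = −1` for a primitive quadratic character of conductor `f ≡ 0 (mod 4)`**: the units `≡ 1 (mod f/2)` are `1` and
`1 + f/2`, so `ψ(1 + f/2) = 1` would make `ψ` factor through `f/2`. [cite: MontgomeryVaughan2007, §9.3 Thm. 9.13] -/
theorem apply_one_add_half_eq_neg_one (h4 : 4 ∣ f) (hprim : ψ.IsPrimitive) (hquad : ψ.IsQuadratic) :
    ψ (((1 + f / 2 : ℕ)) : ZMod f) = -1 := by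
  obtain ⟨c, hc⟩ := h4
  have hc0 : 0 < c := by
    rcases Nat.eq_zero_or_pos c with h | h
    · exact absurd (by rw [hc, h] : f = 0) (NeZero.ne f)
    · exact h
  have hf2 : f / 2 = 2 * c := by omega
  have hcop : Nat.Coprime (1 + f / 2) f := by
    rw [hf2, hc]
    have h1 : Nat.Coprime (1 + 2 * c) c := by
      exact (Nat.coprime_add_mul_right_left 1 c 2).2 (Nat.coprime_one_left c)
    have h2 : Nat.Coprime (1 + 2 * c) 4 := by
      have h2' : Nat.Coprime (1 + 2 * c) 2 := Nat.coprime_two_right.2 ⟨c, by ring⟩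
      simpa using h2'.pow_right 2
    exact Nat.Coprime.mul_right h2 h1
  have hu : IsUnit (((1 + f / 2 : ℕ)) : ZMod f) := (ZMod.isUnit_iff_coprime _ _).2 hcop
  rcases apply_eq_one_or_neg_one_of_isUnit hquad hu with h | h
  · exfalso
    have hdvd : f / 2 ∣ f := ⟨2, by omega⟩
    have hlt : f / 2 < f := by omega
    have h1lt : 1 < f / 2 := by omega
    refine not_factorsThrough_of_isPrimitive hprim hdvd hlt (factorsThrough_of_forall_lt hdvd h1lt ψ fun a ha _ hmod => ?_)
    obtain ⟨q, hqdef⟩ : ∃ q, q = a / (f / 2) := ⟨_, rfl⟩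
    have hq : q < 2 := by
      rw [hqdef, Nat.div_lt_iff_lt_mul (by omega)]; omega
    have hdecomp : f / 2 * q + 1 = a := by
      have := Nat.div_add_mod a (f / 2)
      rwa [hmod, ← hqdef] at this
    interval_cases q
    · have : a = 1 := by omega
      rw [this, Nat.cast_one, map_one]
    · have : a = 1 + f / 2 := by omega
      rw [this]; exact h
  · exact h

/-- **`ψ(b + f/2) = −ψ(b)`** for every `b : ℕ` (`f ≡ 0 (mod 4)`): for odd `b`, `b(1 + f/2) ≡ b + f/2 (mod f)`; for even `b` both
sides vanish. [cite: MontgomeryVaughan2007, §9.3 Thm. 9.13] -/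
theorem apply_natCast_add_half (h4 : 4 ∣ f) (hprim : ψ.IsPrimitive) (hquad : ψ.IsQuadratic) (b : ℕ) :
    ψ (((b + f / 2 : ℕ)) : ZMod f) = -ψ ((b : ℕ) : ZMod f) := by
  have h1 := apply_one_add_half_eq_neg_one h4 hprim hquad
  obtain ⟨c, hc⟩ := h4
  have hf2 : f / 2 = 2 * c := by omega
  have hnu : ∀ n : ℕ, n % 2 = 0 → ¬IsUnit ((n : ℕ) : ZMod f) := by
    intro n hn hun
    rw [ZMod.isUnit_iff_coprime] at hun
    have h2 : Nat.Coprime n 2 := Nat.Coprime.coprime_dvd_right ⟨2 * c, by rw [hc]; ring⟩ hun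
    have := Nat.coprime_two_right.1 h2
    rw [Nat.odd_iff] at this
    omega
  rcases Nat.even_or_odd b with hb | hb
  · have hb2 : b % 2 = 0 := Nat.even_iff.1 hb
    rw [MulChar.map_nonunit _ (hnu b hb2), MulChar.map_nonunit _ (hnu _ (by omega)), neg_zero]
  · obtain ⟨d, rfl⟩ := hb
    have key : (((2 * d + 1 + f / 2 : ℕ)) : ZMod f) = ((2 * d + 1 : ℕ) : ZMod f) * ((1 + f / 2 : ℕ) : ZMod f) := by
      rw [← Nat.cast_mul, ZMod.natCast_eq_natCast_iff', hf2,
        show (2 * d + 1) * (1 + 2 * c) = (2 * d + 1 + 2 * c) + f * d by rw [hc]; ring, Nat.add_mul_mod_self_left]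
    rw [key, map_mul, h1, mul_neg_one]

/-- **`‖B_{1,ψ}‖ = |Σ_{b<f/2} F(b)| / 2` for an even conductor** (`4 ∣ f`; `ψ(b) = F(b) ∈ ℤ` on `b < f`): from
`Σ_{b<f}ψ(b)(2b − f) = −f·Σ_{b<f/2}ψ(b)` by `ψ(b + f/2) = −ψ(b)` (the classical `h(−4m) = ½Σ_{b<2m}χ(b)`).
[cite: IrelandRosen1982, Ch. 15 §2] [cite: Lang1990, Ch. 2 §1] -/
theorem norm_bernoulliOneChar_eq_natAbs_halfSum_div_two (h4 : 4 ∣ f) (hprim : ψ.IsPrimitive) (hquad : ψ.IsQuadratic)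
    {F : ℕ → ℤ} (hF : ∀ b, b < f → ψ (b : ZMod f) = (F b : ℂ)) :
    ‖bernoulliOneChar ψ‖ = ((∑ b ∈ Finset.range (f / 2), F b).natAbs : ℝ) / 2 := by
  rw [norm_bernoulliOneChar_eq_natAbs_sum_div ψ hF]
  have hf2 : f / 2 + f / 2 = f := by obtain ⟨c, hc⟩ := h4; omega
  have hneg : ∀ b, b < f / 2 → F (f / 2 + b) = -F b := by
    intro b hb
    have h1 := hF (b + f / 2) (by omega)
    rw [apply_natCast_add_half h4 hprim hquad b, hF b (by omega)] at h1
    have h2 : ((F (b + f / 2) : ℤ) : ℂ) = ((-F b : ℤ) : ℂ) := by rw [Int.cast_neg]; exact h1.symm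
    rw [add_comm]
    exact_mod_cast h2
  have hrange : Finset.range f = Finset.range (f / 2 + f / 2) := by rw [hf2]
  have e2 : ((f / 2 : ℕ) : ℤ) * 2 = (f : ℤ) := by exact_mod_cast (by omega : f / 2 * 2 = f)
  have hsum : ∑ b ∈ Finset.range f, F b * (2 * (b : ℤ) - f) = -(f : ℤ) * ∑ b ∈ Finset.range (f / 2), F b := by
    rw [hrange, Finset.sum_range_add, ← Finset.sum_add_distrib, Finset.mul_sum]
    refine Finset.sum_congr rfl fun b hb => ?_
    rw [hneg b (Finset.mem_range.1 hb), Nat.cast_add]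
    linear_combination (-(F b)) * e2
  have hf0 : (f : ℝ) ≠ 0 := Nat.cast_ne_zero.2 (NeZero.ne f)
  rw [hsum, Int.natAbs_mul, Int.natAbs_neg, Int.natAbs_natCast, Nat.cast_mul]
  field_simp

end EvenHalf

/-! ## §3 The values of `|B_{1,ψ}|` at the conductors `3, 4, 7, 8, 11, 15, 20, 24, 35, 39, 56, 84` -/

section Values

variable {f : ℕ} [NeZero f] {ψ : DirichletCharacter ℂ f}

/-- `f = 3`: `|B_{1,ψ}| = 1/3` (`ψ = χ₋₃`). [cite: MontgomeryVaughan2007, §9.3 Thm. 9.13] [cite: IrelandRosen1982, Ch. 8 Exercise 28 (c)] -/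
theorem norm_bernoulliOneChar_eq_of_eq_three (hf : f = 3) (hprim : ψ.IsPrimitive) (hquad : ψ.IsQuadratic) (hodd : ψ.Odd) :
    ‖bernoulliOneChar ψ‖ = 1 / 3 := by
  subst hf
  have hfo : Odd 3 := by decide
  have h2 : ψ (2 : ZMod 3) = -1 := apply_two_eq_neg_one_of_odd hfo hprim hquad hodd (by decide)
  have hval : ∀ b : ℕ, b < 3 → ψ (b : ZMod 3) =
      (((([3] : List ℕ).map fun p => if b % p = 0 then (0 : ℤ) else if b ^ (p / 2) % p = 1 then 1 else -1).prod : ℤ) : ℂ) :=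
    fun b _ => apply_natCast_eq_prod_ite_of_odd hfo hprim hquad (ps := [3]) (by norm_num) (by norm_num) b
  rw [norm_bernoulliOneChar_eq_natAbs_halfSum_div_three hfo h2 hval]
  have h : (∑ b ∈ Finset.range ((3 + 1) / 2),
      (([3] : List ℕ).map fun p => if b % p = 0 then (0 : ℤ) else if b ^ (p / 2) % p = 1 then 1 else -1).prod).natAbs = 1 := by
    decide +kernel
  rw [h]; norm_num

/-- `f = 11`: `|B_{1,ψ}| = 1` (`h(−11) = 1`). [cite: MontgomeryVaughan2007, §9.3 Thm. 9.13] [cite: IrelandRosen1982, Ch. 8 Exercise 28 (c)] -/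
theorem norm_bernoulliOneChar_eq_of_eq_eleven (hf : f = 11) (hprim : ψ.IsPrimitive) (hquad : ψ.IsQuadratic) (hodd : ψ.Odd) :
    ‖bernoulliOneChar ψ‖ = 1 := by
  subst hf
  have hfo : Odd 11 := by decide
  have h2 : ψ (2 : ZMod 11) = -1 := apply_two_eq_neg_one_of_odd hfo hprim hquad hodd (by decide)
  have hval : ∀ b : ℕ, b < 11 → ψ (b : ZMod 11) =
      (((([11] : List ℕ).map fun p => if b % p = 0 then (0 : ℤ) else if b ^ (p / 2) % p = 1 then 1 else -1).prod : ℤ) : ℂ) :=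
    fun b _ => apply_natCast_eq_prod_ite_of_odd hfo hprim hquad (ps := [11]) (by norm_num) (by norm_num) b
  rw [norm_bernoulliOneChar_eq_natAbs_halfSum_div_three hfo h2 hval]
  have h : (∑ b ∈ Finset.range ((11 + 1) / 2),
      (([11] : List ℕ).map fun p => if b % p = 0 then (0 : ℤ) else if b ^ (p / 2) % p = 1 then 1 else -1).prod).natAbs = 3 := by
    decide +kernel
  rw [h]; norm_num

/-- `f = 35`: `|B_{1,ψ}| = 2` (`h(−35) = 2`). [cite: MontgomeryVaughan2007, §9.3 Thm. 9.13] [cite: IrelandRosen1982, Ch. 8 Exercise 28 (c)] -/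
theorem norm_bernoulliOneChar_eq_of_eq_thirtyFive (hf : f = 35) (hprim : ψ.IsPrimitive) (hquad : ψ.IsQuadratic) (hodd : ψ.Odd) :
    ‖bernoulliOneChar ψ‖ = 2 := by
  subst hf
  have hfo : Odd 35 := by decide
  have h2 : ψ (2 : ZMod 35) = -1 := apply_two_eq_neg_one_of_odd hfo hprim hquad hodd (by decide)
  have hval : ∀ b : ℕ, b < 35 → ψ (b : ZMod 35) =
      (((([5, 7] : List ℕ).map fun p => if b % p = 0 then (0 : ℤ) else if b ^ (p / 2) % p = 1 then 1 else -1).prod : ℤ) : ℂ) :=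
    fun b _ => apply_natCast_eq_prod_ite_of_odd hfo hprim hquad (ps := [5, 7]) (by norm_num) (by norm_num) b
  rw [norm_bernoulliOneChar_eq_natAbs_halfSum_div_three hfo h2 hval]
  have h : (∑ b ∈ Finset.range ((35 + 1) / 2),
      (([5, 7] : List ℕ).map fun p => if b % p = 0 then (0 : ℤ) else if b ^ (p / 2) % p = 1 then 1 else -1).prod).natAbs = 6 := by
    decide +kernel
  rw [h]; norm_num

/-- `f = 7`: `|B_{1,ψ}| = 1` (`h(−7) = 1`). [cite: MontgomeryVaughan2007, §9.3 Thm. 9.13] [cite: IrelandRosen1982, Ch. 8 Exercise 28 (d)] -/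
theorem norm_bernoulliOneChar_eq_of_eq_seven (hf : f = 7) (hprim : ψ.IsPrimitive) (hquad : ψ.IsQuadratic) (hodd : ψ.Odd) :
    ‖bernoulliOneChar ψ‖ = 1 := by
  subst hf
  have hfo : Odd 7 := by decide
  have h2 : ψ (2 : ZMod 7) = 1 := apply_two_eq_one_of_odd hfo hprim hquad hodd (by decide)
  have hval : ∀ b : ℕ, b < 7 → ψ (b : ZMod 7) =
      (((([7] : List ℕ).map fun p => if b % p = 0 then (0 : ℤ) else if b ^ (p / 2) % p = 1 then 1 else -1).prod : ℤ) : ℂ) :=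
    fun b _ => apply_natCast_eq_prod_ite_of_odd hfo hprim hquad (ps := [7]) (by norm_num) (by norm_num) b
  rw [norm_bernoulliOneChar_eq_natAbs_halfSum hfo (OddCharLogDeriv.ne_one_of_odd hodd) h2 hval]
  have h : (∑ b ∈ Finset.range ((7 + 1) / 2),
      (([7] : List ℕ).map fun p => if b % p = 0 then (0 : ℤ) else if b ^ (p / 2) % p = 1 then 1 else -1).prod).natAbs = 1 := by
    decide +kernel
  rw [h]; norm_num

/-- `f = 15`: `|B_{1,ψ}| = 2` (`h(−15) = 2`). [cite: MontgomeryVaughan2007, §9.3 Thm. 9.13] [cite: IrelandRosen1982, Ch. 8 Exercise 28 (d)] -/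
theorem norm_bernoulliOneChar_eq_of_eq_fifteen (hf : f = 15) (hprim : ψ.IsPrimitive) (hquad : ψ.IsQuadratic) (hodd : ψ.Odd) :
    ‖bernoulliOneChar ψ‖ = 2 := by
  subst hf
  have hfo : Odd 15 := by decide
  have h2 : ψ (2 : ZMod 15) = 1 := apply_two_eq_one_of_odd hfo hprim hquad hodd (by decide)
  have hval : ∀ b : ℕ, b < 15 → ψ (b : ZMod 15) =
      (((([3, 5] : List ℕ).map fun p => if b % p = 0 then (0 : ℤ) else if b ^ (p / 2) % p = 1 then 1 else -1).prod : ℤ) : ℂ) :=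
    fun b _ => apply_natCast_eq_prod_ite_of_odd hfo hprim hquad (ps := [3, 5]) (by norm_num) (by norm_num) b
  rw [norm_bernoulliOneChar_eq_natAbs_halfSum hfo (OddCharLogDeriv.ne_one_of_odd hodd) h2 hval]
  have h : (∑ b ∈ Finset.range ((15 + 1) / 2),
      (([3, 5] : List ℕ).map fun p => if b % p = 0 then (0 : ℤ) else if b ^ (p / 2) % p = 1 then 1 else -1).prod).natAbs = 2 := by
    decide +kernel
  rw [h]; norm_num

/-- `f = 39`: `|B_{1,ψ}| = 4` (`h(−39) = 4`). [cite: MontgomeryVaughan2007, §9.3 Thm. 9.13] [cite: IrelandRosen1982, Ch. 8 Exercise 28 (d)] -/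
theorem norm_bernoulliOneChar_eq_of_eq_thirtyNine (hf : f = 39) (hprim : ψ.IsPrimitive) (hquad : ψ.IsQuadratic) (hodd : ψ.Odd) :
    ‖bernoulliOneChar ψ‖ = 4 := by
  subst hf
  have hfo : Odd 39 := by decide
  have h2 : ψ (2 : ZMod 39) = 1 := apply_two_eq_one_of_odd hfo hprim hquad hodd (by decide)
  have hval : ∀ b : ℕ, b < 39 → ψ (b : ZMod 39) =
      (((([3, 13] : List ℕ).map fun p => if b % p = 0 then (0 : ℤ) else if b ^ (p / 2) % p = 1 then 1 else -1).prod : ℤ) : ℂ) :=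
    fun b _ => apply_natCast_eq_prod_ite_of_odd hfo hprim hquad (ps := [3, 13]) (by norm_num) (by norm_num) b
  rw [norm_bernoulliOneChar_eq_natAbs_halfSum hfo (OddCharLogDeriv.ne_one_of_odd hodd) h2 hval]
  have h : (∑ b ∈ Finset.range ((39 + 1) / 2),
      (([3, 13] : List ℕ).map fun p => if b % p = 0 then (0 : ℤ) else if b ^ (p / 2) % p = 1 then 1 else -1).prod).natAbs = 4 := by
    decide +kernel
  rw [h]; norm_num

/-- `f = 4`: `|B_{1,ψ}| = 1/2` (`ψ = χ₋₄`). [cite: MontgomeryVaughan2007, §9.3 Thm. 9.13] [cite: IrelandRosen1982, Ch. 15 §2] -/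
theorem norm_bernoulliOneChar_eq_of_eq_four (hf : f = 4) (hprim : ψ.IsPrimitive) (hquad : ψ.IsQuadratic) (hodd : ψ.Odd) :
    ‖bernoulliOneChar ψ‖ = 1 / 2 := by
  subst hf
  have hval : ∀ b : ℕ, b < 4 → ψ (b : ZMod 4) =
      (((if b % 2 = 0 then (0 : ℤ) else if b % 4 = 1 then 1 else -1) *
        (([] : List ℕ).map fun p => if b % p = 0 then (0 : ℤ) else if b ^ (p / 2) % p = 1 then 1 else -1).prod : ℤ) : ℂ) :=
    fun b _ => apply_natCast_eq_prod_ite_of_eq_four_mul (m := 1) (by norm_num) (by decide) hprim hquad (ps := []) (by simp)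
      (by norm_num) b
  rw [norm_bernoulliOneChar_eq_natAbs_halfSum_div_two (by norm_num) hprim hquad hval]
  have h : (∑ b ∈ Finset.range (4 / 2), (if b % 2 = 0 then (0 : ℤ) else if b % 4 = 1 then 1 else -1) *
      (([] : List ℕ).map fun p => if b % p = 0 then (0 : ℤ) else if b ^ (p / 2) % p = 1 then 1 else -1).prod).natAbs = 1 := by
    decide +kernel
  rw [h]; norm_num

/-- `f = 20`: `|B_{1,ψ}| = 2` (`h(−20) = 2`). [cite: MontgomeryVaughan2007, §9.3 Thm. 9.13] [cite: IrelandRosen1982, Ch. 15 §2] -/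
theorem norm_bernoulliOneChar_eq_of_eq_twenty (hf : f = 20) (hprim : ψ.IsPrimitive) (hquad : ψ.IsQuadratic) (hodd : ψ.Odd) :
    ‖bernoulliOneChar ψ‖ = 2 := by
  subst hf
  have hval : ∀ b : ℕ, b < 20 → ψ (b : ZMod 20) =
      (((if b % 2 = 0 then (0 : ℤ) else if b % 4 = 1 then 1 else -1) *
        (([5] : List ℕ).map fun p => if b % p = 0 then (0 : ℤ) else if b ^ (p / 2) % p = 1 then 1 else -1).prod : ℤ) : ℂ) :=
    fun b _ => apply_natCast_eq_prod_ite_of_eq_four_mul (m := 5) (by norm_num) (by decide) hprim hquad (ps := [5]) (by norm_num)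
      (by norm_num) b
  rw [norm_bernoulliOneChar_eq_natAbs_halfSum_div_two (by norm_num) hprim hquad hval]
  have h : (∑ b ∈ Finset.range (20 / 2), (if b % 2 = 0 then (0 : ℤ) else if b % 4 = 1 then 1 else -1) *
      (([5] : List ℕ).map fun p => if b % p = 0 then (0 : ℤ) else if b ^ (p / 2) % p = 1 then 1 else -1).prod).natAbs = 4 := by
    decide +kernel
  rw [h]; norm_num

/-- `f = 84`: `|B_{1,ψ}| = 4` (`h(−84) = 4`). [cite: MontgomeryVaughan2007, §9.3 Thm. 9.13] [cite: IrelandRosen1982, Ch. 15 §2] -/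
theorem norm_bernoulliOneChar_eq_of_eq_eightyFour (hf : f = 84) (hprim : ψ.IsPrimitive) (hquad : ψ.IsQuadratic) (hodd : ψ.Odd) :
    ‖bernoulliOneChar ψ‖ = 4 := by
  subst hf
  have hval : ∀ b : ℕ, b < 84 → ψ (b : ZMod 84) =
      (((if b % 2 = 0 then (0 : ℤ) else if b % 4 = 1 then 1 else -1) *
        (([3, 7] : List ℕ).map fun p => if b % p = 0 then (0 : ℤ) else if b ^ (p / 2) % p = 1 then 1 else -1).prod : ℤ) : ℂ) :=
    fun b _ => apply_natCast_eq_prod_ite_of_eq_four_mul (m := 21) (by norm_num) (by decide) hprim hquad (ps := [3, 7]) (by norm_num)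
      (by norm_num) b
  rw [norm_bernoulliOneChar_eq_natAbs_halfSum_div_two (by norm_num) hprim hquad hval]
  have h : (∑ b ∈ Finset.range (84 / 2), (if b % 2 = 0 then (0 : ℤ) else if b % 4 = 1 then 1 else -1) *
      (([3, 7] : List ℕ).map fun p => if b % p = 0 then (0 : ℤ) else if b ^ (p / 2) % p = 1 then 1 else -1).prod).natAbs = 8 := by
    decide +kernel
  rw [h]; norm_num

/-- `f = 8`: `|B_{1,ψ}| = 1` (`ψ = χ₋₈`, `h(−8) = 1`). [cite: MontgomeryVaughan2007, §9.3 Thm. 9.13] [cite: IrelandRosen1982, Ch. 15 §2] -/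
theorem norm_bernoulliOneChar_eq_of_eq_eight (hf : f = 8) (hprim : ψ.IsPrimitive) (hquad : ψ.IsQuadratic) (hodd : ψ.Odd) :
    ‖bernoulliOneChar ψ‖ = 1 := by
  subst hf
  have hval : ∀ b : ℕ, b < 8 → ψ (b : ZMod 8) =
      (((if b % 2 = 0 then (0 : ℤ) else if (1 : ℕ) % 4 = 1 then (if b % 8 = 1 ∨ b % 8 = 3 then 1 else -1)
          else (if b % 8 = 1 ∨ b % 8 = 7 then 1 else -1)) *
        (([] : List ℕ).map fun p => if b % p = 0 then (0 : ℤ) else if b ^ (p / 2) % p = 1 then 1 else -1).prod : ℤ) : ℂ) :=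
    fun b _ => apply_natCast_eq_prod_ite_of_eq_eight_mul (m := 1) (by norm_num) (by decide) hprim hquad hodd (ps := []) (by simp)
      (by norm_num) b
  rw [norm_bernoulliOneChar_eq_natAbs_halfSum_div_two (by norm_num) hprim hquad hval]
  have h : (∑ b ∈ Finset.range (8 / 2), (if b % 2 = 0 then (0 : ℤ) else if (1 : ℕ) % 4 = 1 then
      (if b % 8 = 1 ∨ b % 8 = 3 then 1 else -1) else (if b % 8 = 1 ∨ b % 8 = 7 then 1 else -1)) *
      (([] : List ℕ).map fun p => if b % p = 0 then (0 : ℤ) else if b ^ (p / 2) % p = 1 then 1 else -1).prod).natAbs = 2 := by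
    decide +kernel
  rw [h]; norm_num

/-- `f = 24`: `|B_{1,ψ}| = 2` (`h(−24) = 2`). [cite: MontgomeryVaughan2007, §9.3 Thm. 9.13] [cite: IrelandRosen1982, Ch. 15 §2] -/
theorem norm_bernoulliOneChar_eq_of_eq_twentyFour (hf : f = 24) (hprim : ψ.IsPrimitive) (hquad : ψ.IsQuadratic) (hodd : ψ.Odd) :
    ‖bernoulliOneChar ψ‖ = 2 := by
  subst hf
  have hval : ∀ b : ℕ, b < 24 → ψ (b : ZMod 24) =
      (((if b % 2 = 0 then (0 : ℤ) else if (3 : ℕ) % 4 = 1 then (if b % 8 = 1 ∨ b % 8 = 3 then 1 else -1)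
          else (if b % 8 = 1 ∨ b % 8 = 7 then 1 else -1)) *
        (([3] : List ℕ).map fun p => if b % p = 0 then (0 : ℤ) else if b ^ (p / 2) % p = 1 then 1 else -1).prod : ℤ) : ℂ) :=
    fun b _ => apply_natCast_eq_prod_ite_of_eq_eight_mul (m := 3) (by norm_num) (by decide) hprim hquad hodd (ps := [3]) (by norm_num)
      (by norm_num) b
  rw [norm_bernoulliOneChar_eq_natAbs_halfSum_div_two (by norm_num) hprim hquad hval]
  have h : (∑ b ∈ Finset.range (24 / 2), (if b % 2 = 0 then (0 : ℤ) else if (3 : ℕ) % 4 = 1 then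
      (if b % 8 = 1 ∨ b % 8 = 3 then 1 else -1) else (if b % 8 = 1 ∨ b % 8 = 7 then 1 else -1)) *
      (([3] : List ℕ).map fun p => if b % p = 0 then (0 : ℤ) else if b ^ (p / 2) % p = 1 then 1 else -1).prod).natAbs = 4 := by
    decide +kernel
  rw [h]; norm_num

/-- `f = 56`: `|B_{1,ψ}| = 4` (`h(−56) = 4`). [cite: MontgomeryVaughan2007, §9.3 Thm. 9.13] [cite: IrelandRosen1982, Ch. 15 §2] -/
theorem norm_bernoulliOneChar_eq_of_eq_fiftySix (hf : f = 56) (hprim : ψ.IsPrimitive) (hquad : ψ.IsQuadratic) (hodd : ψ.Odd) :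
    ‖bernoulliOneChar ψ‖ = 4 := by
  subst hf
  have hval : ∀ b : ℕ, b < 56 → ψ (b : ZMod 56) =
      (((if b % 2 = 0 then (0 : ℤ) else if (7 : ℕ) % 4 = 1 then (if b % 8 = 1 ∨ b % 8 = 3 then 1 else -1)
          else (if b % 8 = 1 ∨ b % 8 = 7 then 1 else -1)) *
        (([7] : List ℕ).map fun p => if b % p = 0 then (0 : ℤ) else if b ^ (p / 2) % p = 1 then 1 else -1).prod : ℤ) : ℂ) :=
    fun b _ => apply_natCast_eq_prod_ite_of_eq_eight_mul (m := 7) (by norm_num) (by decide) hprim hquad hodd (ps := [7]) (by norm_num)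
      (by norm_num) b
  rw [norm_bernoulliOneChar_eq_natAbs_halfSum_div_two (by norm_num) hprim hquad hval]
  have h : (∑ b ∈ Finset.range (56 / 2), (if b % 2 = 0 then (0 : ℤ) else if (7 : ℕ) % 4 = 1 then
      (if b % 8 = 1 ∨ b % 8 = 3 then 1 else -1) else (if b % 8 = 1 ∨ b % 8 = 7 then 1 else -1)) *
      (([7] : List ℕ).map fun p => if b % p = 0 then (0 : ℤ) else if b ^ (p / 2) % p = 1 then 1 else -1).prod).natAbs = 8 := by
    decide +kernel
  rw [h]; norm_num

end Values

/-! ## §4 The classification theorems -/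

section Classification

variable {f : ℕ} [NeZero f] {ψ : DirichletCharacter ℂ f}

/-- The entries of a certificate factor list are primes. [folklore] -/
private theorem primes_of_cert {n : ℕ} (hn : n < 22201) {ps : List ℕ} (hprod : ps.prod ∣ n) (hn0 : n ≠ 0)
    (hpc : ∀ p ∈ ps, 1 < p ∧ ∀ d ∈ ([2, 3, 5, 7, 11, 13, 17, 19, 23, 29, 31, 37, 41, 43, 47, 53, 59, 61, 67, 71, 73, 79, 83, 89, 97, 101,
        103, 107, 109, 113, 127, 131, 137, 139] : List ℕ), d * d ≤ p → p % d ≠ 0) :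
    ∀ p ∈ ps, p.Prime := fun p hp => by
  obtain ⟨h1, htd⟩ := hpc p hp
  have hple : p ≤ n := Nat.le_of_dvd (Nat.pos_of_ne_zero hn0) ((List.dvd_prod hp).trans hprod)
  exact prime_of_trialDivision h1 (by omega) htd

/-- A square factor `p²` with `p` from the list of odd primes `≤ 139` contradicts squarefreeness. [folklore] -/
private theorem not_sq_dvd_of_squarefree {n : ℕ} (hsq : Squarefree n) :
    ¬∃ p ∈ ([3, 5, 7, 11, 13, 17, 19, 23, 29, 31, 37, 41, 43, 47, 53, 59, 61, 67, 71, 73, 79, 83, 89, 97, 101, 103, 107, 109, 113, 127,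
        131, 137, 139] : List ℕ), p * p ∣ n := by
  rintro ⟨p, hp, hdvd⟩
  exact (sp_facts.1 p hp).ne_one (Nat.isUnit_iff.1 (hsq p hdvd))

/-- **THEOREM A.**  For an odd primitive quadratic character `ψ` of ODD conductor `f` with `ψ(2) = −1`:
**`φ(f) ≤ 12·|B_{1,ψ}|` implies `f ∈ {3, 11, 35}`** (and conversely `|B_{1,ψ}| = 1/3, 1, 2` there).  In class-number terms: the
imaginary quadratic fields `ℚ(√−f)`, `f ≡ 3 (mod 8)` squarefree, with `12h(−f) ≥ (w/2)·φ(f)` are `ℚ(√−3), ℚ(√−11), ℚ(√−35)`.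
[cite: MontgomeryVaughan2007, §9.3 Thm. 9.13] [cite: Oesterle1988Gauss, II §3 (27)] [cite: BauerCosteItzyksonRuelle1997, §3.4] -/
theorem eq_of_totient_le_twelve_mul_norm_bernoulliOneChar (hfo : Odd f) (hprim : ψ.IsPrimitive) (hquad : ψ.IsQuadratic)
    (hodd : ψ.Odd) (h2 : ψ (2 : ZMod f) = -1) (hle : (Nat.totient f : ℝ) ≤ 12 * ‖bernoulliOneChar ψ‖) :
    f = 3 ∨ f = 11 ∨ f = 35 := by
  have hsq := squarefree_of_isPrimitive_of_isQuadratic hfo hprim hquad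
  have hf4 := mod_four_eq_three_of_odd hfo hprim hquad hodd
  have hf8 : f % 8 = 3 := by
    by_contra h8
    have h81 : (-(f : ℤ)) % 8 = 1 := by omega
    have := apply_two_eq_one_of_odd hfo hprim hquad hodd h81
    rw [this] at h2
    norm_num at h2
  have hf1 : f ≠ 1 := by omega
  have hT2 := norm_bernoulliOneChar_le_sqrt_mul_log hprim hodd hf1
  have hA : (Nat.totient f : ℝ) ≤ 12 * (Real.pi⁻¹ * Real.sqrt f * Real.log f) := hle.trans (by linarith)
  rcases Nat.lt_or_ge f 20000 with hbig | hbig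
  swap
  · exfalso
    have h221 := lt_two_pow_of_totient_le (by omega) hA
    have hr := totient_ge_of_odd_squarefree hfo hsq (lt_trans h221 (by norm_num))
    exact not_le_twelve_mul_of_le hbig (hr.trans hA)
  · obtain ⟨k, hk⟩ : ∃ k, f = 8 * k + 3 := ⟨f / 8, by omega⟩
    have hk2500 : k < 2500 := by omega
    subst hk
    rcases sweep_three_mod_eight k (Finset.mem_range.2 hk2500) with hsqf | hcrit | htab | hsol
    · exact absurd hsqf (not_sq_dvd_of_squarefree hsq)
    · exfalso
      have hφ := totient_eq_trialDivision hfo hsq (by omega)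
      have hlog := two_mul_log_le_table (f := 8 * k + 3) (by omega) (by omega)
      have hlt := twelve_mul_lt_totient_of_crit (f := 8 * k + 3) (by omega) hlog (le_of_eq (by exact_mod_cast hφ.symm)) hcrit
      linarith
    · exfalso
      rw [← prods_three_mod_eight] at htab
      obtain ⟨ps, hps, hprod⟩ := List.mem_map.1 htab
      obtain ⟨hpc, hcert⟩ := cert_three_mod_eight ps hps
      have hprime : ∀ p ∈ ps, p.Prime := primes_of_cert (n := 8 * k + 3) (by omega) (dvd_of_eq hprod) (by omega) hpc
      have hnd : ps.Nodup := nodup_of_squarefree_listProd hprime (by rw [hprod]; exact hsq)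
      have hφ : Nat.totient (8 * k + 3) = (ps.map fun p => p - 1).prod := by
        rw [← hprod]; exact totient_listProd_eq hprime hnd
      have hval : ∀ b : ℕ, b < 8 * k + 3 → ψ (b : ZMod (8 * k + 3)) =
          (((ps.map fun p => if b % p = 0 then (0 : ℤ) else if b ^ (p / 2) % p = 1 then 1 else -1).prod : ℤ) : ℂ) :=
        fun b _ => apply_natCast_eq_prod_ite_of_odd hfo hprim hquad hprime hprod b
      have hB := norm_bernoulliOneChar_eq_natAbs_halfSum_div_three hfo h2 hval
      rw [hprod] at hcert
      have hcR : (4 : ℝ) * ((∑ b ∈ Finset.range ((8 * k + 3 + 1) / 2),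
          (ps.map fun p => if b % p = 0 then (0 : ℤ) else if b ^ (p / 2) % p = 1 then 1 else -1).prod).natAbs : ℝ) <
          (((ps.map fun p => p - 1).prod : ℕ) : ℝ) := by
        exact_mod_cast hcert
      rw [hB] at hle
      rw [hφ] at hle
      linarith
    · simpa using hsol

/-- **THEOREM B (odd conductors, the bound `6`).**  For an odd primitive quadratic character `ψ` of odd conductor `f`:
**`φ(f) ≤ 6·|B_{1,ψ}|` implies `f ∈ {3, 7, 15, 39}`** (`12h(−f) ≥ w·φ(f)`: `ℚ(√−3), ℚ(√−7), ℚ(√−15), ℚ(√−39)`).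
[cite: MontgomeryVaughan2007, §9.3 Thm. 9.13] [cite: Oesterle1988Gauss, II §3 (27)] [cite: BauerCosteItzyksonRuelle1997, §3.4] -/
theorem mem_of_totient_le_six_mul_norm_bernoulliOneChar_of_odd (hfo : Odd f) (hprim : ψ.IsPrimitive) (hquad : ψ.IsQuadratic)
    (hodd : ψ.Odd) (hle : (Nat.totient f : ℝ) ≤ 6 * ‖bernoulliOneChar ψ‖) :
    f = 3 ∨ f = 7 ∨ f = 15 ∨ f = 39 := by
  have hsq := squarefree_of_isPrimitive_of_isQuadratic hfo hprim hquad
  have hf4 := mod_four_eq_three_of_odd hfo hprim hquad hodd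
  have hf1 : f ≠ 1 := by omega
  have hψ1 : ψ ≠ 1 := OddCharLogDeriv.ne_one_of_odd hodd
  have hT2 := norm_bernoulliOneChar_le_sqrt_mul_log hprim hodd hf1
  have hB0 : 0 ≤ ‖bernoulliOneChar ψ‖ := norm_nonneg _
  by_cases hf8 : f % 8 = 3
  · -- `ψ(2) = −1`: Theorem A, then the exact values exclude `11` and `35`
    have h2 : ψ (2 : ZMod f) = -1 := apply_two_eq_neg_one_of_odd hfo hprim hquad hodd (by omega)
    rcases eq_of_totient_le_twelve_mul_norm_bernoulliOneChar hfo hprim hquad hodd h2 (by linarith) with h | h | h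
    · exact Or.inl h
    · exfalso
      rw [norm_bernoulliOneChar_eq_of_eq_eleven h hprim hquad hodd, h] at hle
      have : Nat.totient 11 = 10 := by decide
      rw [this] at hle; norm_num at hle
    · exfalso
      rw [norm_bernoulliOneChar_eq_of_eq_thirtyFive h hprim hquad hodd, h] at hle
      have : Nat.totient 35 = 24 := by decide
      rw [this] at hle; norm_num at hle
  · have hf87 : f % 8 = 7 := by omega
    have h2 : ψ (2 : ZMod f) = 1 := apply_two_eq_one_of_odd hfo hprim hquad hodd (by omega)
    have hA : (Nat.totient f : ℝ) ≤ 12 * (Real.pi⁻¹ * Real.sqrt f * Real.log f) := hle.trans (by linarith)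
    rcases Nat.lt_or_ge f 20000 with hbig | hbig
    swap
    · exfalso
      have h221 := lt_two_pow_of_totient_le (by omega) hA
      have hr := totient_ge_of_odd_squarefree hfo hsq (lt_trans h221 (by norm_num))
      exact not_le_twelve_mul_of_le hbig (hr.trans hA)
    · obtain ⟨k, hk⟩ : ∃ k, f = 8 * k + 7 := ⟨f / 8, by omega⟩
      have hk2500 : k < 2500 := by omega
      subst hk
      rcases sweep_seven_mod_eight k (Finset.mem_range.2 hk2500) with hsqf | hcrit | htab | hsol
      · exact absurd hsqf (not_sq_dvd_of_squarefree hsq)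
      · exfalso
        have hφ := totient_eq_trialDivision hfo hsq (by omega)
        have hlog := two_mul_log_le_table (f := 8 * k + 7) (by omega) (by omega)
        have hlt := six_mul_lt_totient_of_crit (f := 8 * k + 7) (by omega) hlog (le_of_eq (by exact_mod_cast hφ.symm)) hcrit
        have h6 : 6 * ‖bernoulliOneChar ψ‖ ≤ 6 * (Real.pi⁻¹ * Real.sqrt (8 * k + 7 : ℕ) * Real.log (8 * k + 7 : ℕ)) := by linarith
        linarith
      · exfalso
        rw [← prods_seven_mod_eight] at htab
        obtain ⟨ps, hps, hprod⟩ := List.mem_map.1 htab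
        obtain ⟨hpc, hcert⟩ := cert_seven_mod_eight ps hps
        have hprime : ∀ p ∈ ps, p.Prime := primes_of_cert (n := 8 * k + 7) (by omega) (dvd_of_eq hprod) (by omega) hpc
        have hnd : ps.Nodup := nodup_of_squarefree_listProd hprime (by rw [hprod]; exact hsq)
        have hφ : Nat.totient (8 * k + 7) = (ps.map fun p => p - 1).prod := by
          rw [← hprod]; exact totient_listProd_eq hprime hnd
        have hval : ∀ b : ℕ, b < 8 * k + 7 → ψ (b : ZMod (8 * k + 7)) =
            (((ps.map fun p => if b % p = 0 then (0 : ℤ) else if b ^ (p / 2) % p = 1 then 1 else -1).prod : ℤ) : ℂ) :=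
          fun b _ => apply_natCast_eq_prod_ite_of_odd hfo hprim hquad hprime hprod b
        have hB := norm_bernoulliOneChar_eq_natAbs_halfSum hfo hψ1 h2 hval
        rw [hprod] at hcert
        have hcR : (6 : ℝ) * ((∑ b ∈ Finset.range ((8 * k + 7 + 1) / 2),
            (ps.map fun p => if b % p = 0 then (0 : ℤ) else if b ^ (p / 2) % p = 1 then 1 else -1).prod).natAbs : ℝ) <
            (((ps.map fun p => p - 1).prod : ℕ) : ℝ) := by
          exact_mod_cast hcert
        rw [hB] at hle
        rw [hφ] at hle
        linarith
      · simp only [List.mem_cons, List.mem_nil_iff, or_false] at hsol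
        rcases hsol with h | h | h
        · exact Or.inr (Or.inl h)
        · exact Or.inr (Or.inr (Or.inl h))
        · exact Or.inr (Or.inr (Or.inr h))

/-- **THEOREM C (even conductors).**  For an odd primitive quadratic character `ψ` of EVEN conductor `f` (so `f = 4m`, `m ≡ 1 (mod 4)`, or
`f = 8m`, `m` odd squarefree): **`φ(f) ≤ 6·|B_{1,ψ}|` implies `f ∈ {4, 8, 20, 24, 56, 84}`**.
[cite: MontgomeryVaughan2007, §9.3 Thm. 9.13] [cite: Oesterle1988Gauss, II §3 (27)] [cite: BauerCosteItzyksonRuelle1997, §3.4] -/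
theorem mem_of_totient_le_six_mul_norm_bernoulliOneChar_of_even (hfe : Even f) (hprim : ψ.IsPrimitive) (hquad : ψ.IsQuadratic)
    (hodd : ψ.Odd) (hle : (Nat.totient f : ℝ) ≤ 6 * ‖bernoulliOneChar ψ‖) :
    f = 4 ∨ f = 8 ∨ f = 20 ∨ f = 24 ∨ f = 56 ∨ f = 84 := by
  obtain ⟨k, m, hm, hfkm⟩ := Nat.exists_eq_two_pow_mul_odd (NeZero.ne f)
  have hm0 : m ≠ 0 := fun h => by simp [h] at hm
  haveI : NeZero m := ⟨hm0⟩
  subst hfkm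
  have hk3 : k ≤ 3 := le_three_of_level_two_pow_mul hm hprim hquad
  have hsqm : Squarefree m := squarefree_of_level_two_pow_mul hm hprim hquad
  have hB0 : 0 ≤ ‖bernoulliOneChar ψ‖ := norm_nonneg _
  interval_cases k
  · -- `k = 0`: `f = m` odd, not even
    exfalso
    rw [pow_zero, one_mul] at hfe
    exact (Nat.not_even_iff_odd.2 hm) hfe
  · exact (not_isPrimitive_two_mul hm hprim).elim
  · -- `f = 4m`, `m ≡ 1 (mod 4)`
    have hm4 : m % 4 = 1 := mod_four_eq_one_of_level_four_mul hm hprim hquad hodd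
    have e4 : 2 ^ 2 * m = 4 * m := by norm_num
    have hf1 : 2 ^ 2 * m ≠ 1 := by rw [e4]; omega
    have hT2 := norm_bernoulliOneChar_le_sqrt_mul_log hprim hodd hf1
    have hφ4 : Nat.totient (2 ^ 2 * m) = 2 * Nat.totient m := by
      rw [Nat.totient_mul (Nat.Coprime.pow_left 2 (Nat.coprime_two_left.2 hm))]
      have : Nat.totient (2 ^ 2) = 2 := by decide
      rw [this]
    rcases Nat.lt_or_ge (2 ^ 2 * m) 20000 with hbig | hbig
    swap
    · exfalso
      have hA : (Nat.totient (2 ^ 2 * m) : ℝ) ≤ 12 * (Real.pi⁻¹ * Real.sqrt (2 ^ 2 * m : ℕ) * Real.log (2 ^ 2 * m : ℕ)) :=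
        hle.trans (by linarith)
      have h221 := lt_two_pow_of_totient_le (by rw [e4]; omega) hA
      have hr := totient_ge_of_odd_squarefree hm hsqm (by rw [e4] at h221; norm_num at h221 ⊢; omega)
      have hX : (0.2908 : ℝ) * ((2 ^ 2 * m : ℕ) : ℝ) ≤ 12 * (Real.pi⁻¹ * Real.sqrt (2 ^ 2 * m : ℕ) * Real.log (2 ^ 2 * m : ℕ)) := by
        have h6 : (Nat.totient (2 ^ 2 * m) : ℝ) ≤ 6 * (Real.pi⁻¹ * Real.sqrt (2 ^ 2 * m : ℕ) * Real.log (2 ^ 2 * m : ℕ)) :=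
          hle.trans (by linarith)
        rw [hφ4] at h6
        push_cast at h6 ⊢
        nlinarith [hr, h6]
      exact not_le_twelve_mul_of_le hbig hX
    · obtain ⟨j, hj⟩ : ∃ j, m = 4 * j + 1 := ⟨m / 4, by omega⟩
      have hj1250 : j < 1250 := by rw [e4] at hbig; omega
      subst hj
      rcases sweep_four_mul j (Finset.mem_range.2 hj1250) with hsqf | hcrit | htab | hsol
      · exact absurd hsqf (not_sq_dvd_of_squarefree hsqm)
      · exfalso
        rw [← e4] at hcrit
        have hφ := totient_eq_trialDivision hm hsqm (by omega)
        have hlog := two_mul_log_le_table (f := 2 ^ 2 * (4 * j + 1)) (by rw [e4]; omega) (lt_trans hbig (by norm_num))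
        have hP : (((2 * (((([3, 5, 7, 11, 13, 17, 19, 23, 29, 31, 37, 41, 43, 47, 53, 59, 61, 67, 71, 73, 79, 83, 89, 97, 101, 103, 107,
            109, 113, 127, 131, 137, 139] : List ℕ).filter (· ∣ (4 * j + 1))).map fun p => p - 1).prod *
          (if (4 * j + 1) / (([3, 5, 7, 11, 13, 17, 19, 23, 29, 31, 37, 41, 43, 47, 53, 59, 61, 67, 71, 73, 79, 83, 89, 97, 101, 103,
              107, 109, 113, 127, 131, 137, 139] : List ℕ).filter (· ∣ (4 * j + 1))).prod = 1 then 1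
           else (4 * j + 1) / (([3, 5, 7, 11, 13, 17, 19, 23, 29, 31, 37, 41, 43, 47, 53, 59, 61, 67, 71, 73, 79, 83, 89, 97, 101, 103,
               107, 109, 113, 127, 131, 137,
               139] : List ℕ).filter (· ∣ (4 * j + 1))).prod - 1)) : ℕ)) : ℝ) ≤ (Nat.totient (2 ^ 2 * (4 * j + 1)) : ℝ) := by
          rw [hφ4, hφ]
        have hlt := six_mul_lt_totient_of_crit (f := 2 ^ 2 * (4 * j + 1)) (by rw [e4]; omega) hlog hP hcrit
        have h6 : (Nat.totient (2 ^ 2 * (4 * j + 1)) : ℝ) ≤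
            6 * (Real.pi⁻¹ * Real.sqrt (2 ^ 2 * (4 * j + 1) : ℕ) * Real.log (2 ^ 2 * (4 * j + 1) : ℕ)) :=
          hle.trans (mul_le_mul_of_nonneg_left hT2 (by norm_num))
        exact absurd (h6.trans_lt hlt) (lt_irrefl _)
      · exfalso
        rw [← prods_four_mul] at htab
        obtain ⟨ps, hps, hprod⟩ := List.mem_map.1 htab
        have hprod' : ps.prod = 4 * j + 1 := by omega
        obtain ⟨hpc, hcert⟩ := cert_four_mul ps hps
        have hprime : ∀ p ∈ ps, p.Prime := primes_of_cert (n := 4 * j + 1) (by omega) (dvd_of_eq hprod') (by omega) hpc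
        have hnd : ps.Nodup := nodup_of_squarefree_listProd hprime (by rw [hprod']; exact hsqm)
        have hφ : Nat.totient (2 ^ 2 * (4 * j + 1)) = 2 * (ps.map fun p => p - 1).prod := by
          rw [hφ4, ← totient_listProd_eq hprime hnd, hprod']
        have hval : ∀ b : ℕ, b < 2 ^ 2 * (4 * j + 1) → ψ (b : ZMod (2 ^ 2 * (4 * j + 1))) =
            (((if b % 2 = 0 then (0 : ℤ) else if b % 4 = 1 then 1 else -1) *
              (ps.map fun p => if b % p = 0 then (0 : ℤ) else if b ^ (p / 2) % p = 1 then 1 else -1).prod : ℤ) : ℂ) :=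
          fun b _ => apply_natCast_eq_prod_ite_of_eq_four_mul (m := 4 * j + 1) e4 hm hprim hquad hprime hprod' b
        have hB := norm_bernoulliOneChar_eq_natAbs_halfSum_div_two (f := 2 ^ 2 * (4 * j + 1)) ⟨4 * j + 1, e4⟩ hprim hquad hval
        have hr2 : 2 ^ 2 * (4 * j + 1) / 2 = 2 * (4 * j + 1) := by rw [e4]; omega
        rw [hr2] at hB
        rw [hprod'] at hcert
        have hcR : (3 : ℝ) * ((∑ b ∈ Finset.range (2 * (4 * j + 1)), (if b % 2 = 0 then (0 : ℤ) else if b % 4 = 1 then 1 else -1) *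
            (ps.map fun p => if b % p = 0 then (0 : ℤ) else if b ^ (p / 2) % p = 1 then 1 else -1).prod).natAbs : ℝ) <
            (((2 * (ps.map fun p => p - 1).prod : ℕ)) : ℝ) := by
          exact_mod_cast hcert
        rw [hB, hφ] at hle
        linarith
      · simp only [List.mem_cons, List.mem_nil_iff, or_false] at hsol
        rw [e4]
        omega
  · -- `f = 8m`
    have e8 : 2 ^ 3 * m = 8 * m := by norm_num
    have hf1 : 2 ^ 3 * m ≠ 1 := by rw [e8]; omega
    have hT2 := norm_bernoulliOneChar_le_sqrt_mul_log hprim hodd hf1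
    have hφ8 : Nat.totient (2 ^ 3 * m) = 4 * Nat.totient m := by
      rw [Nat.totient_mul (Nat.Coprime.pow_left 3 (Nat.coprime_two_left.2 hm))]
      have : Nat.totient (2 ^ 3) = 4 := by decide
      rw [this]
    rcases Nat.lt_or_ge (2 ^ 3 * m) 20000 with hbig | hbig
    swap
    · exfalso
      have hA : (Nat.totient (2 ^ 3 * m) : ℝ) ≤ 12 * (Real.pi⁻¹ * Real.sqrt (2 ^ 3 * m : ℕ) * Real.log (2 ^ 3 * m : ℕ)) :=
        hle.trans (by linarith)
      have h221 := lt_two_pow_of_totient_le (by rw [e8]; omega) hA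
      have hr := totient_ge_of_odd_squarefree hm hsqm (by rw [e8] at h221; norm_num at h221 ⊢; omega)
      have hX : (0.2908 : ℝ) * ((2 ^ 3 * m : ℕ) : ℝ) ≤ 12 * (Real.pi⁻¹ * Real.sqrt (2 ^ 3 * m : ℕ) * Real.log (2 ^ 3 * m : ℕ)) := by
        have h6 : (Nat.totient (2 ^ 3 * m) : ℝ) ≤ 6 * (Real.pi⁻¹ * Real.sqrt (2 ^ 3 * m : ℕ) * Real.log (2 ^ 3 * m : ℕ)) :=
          hle.trans (by linarith)
        rw [hφ8] at h6
        push_cast at h6 ⊢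
        nlinarith [hr, h6]
      exact not_le_twelve_mul_of_le hbig hX
    · obtain ⟨j, hj⟩ : ∃ j, m = 2 * j + 1 := ⟨m / 2, by have := Nat.odd_iff.1 hm; omega⟩
      have hj1250 : j < 1250 := by rw [e8] at hbig; omega
      subst hj
      rcases sweep_eight_mul j (Finset.mem_range.2 hj1250) with hsqf | hcrit | htab | hsol
      · exact absurd hsqf (not_sq_dvd_of_squarefree hsqm)
      · exfalso
        rw [← e8] at hcrit
        have hφ := totient_eq_trialDivision hm hsqm (by omega)
        have hlog := two_mul_log_le_table (f := 2 ^ 3 * (2 * j + 1)) (by rw [e8]; omega) (lt_trans hbig (by norm_num))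
        have hP : (((4 * (((([3, 5, 7, 11, 13, 17, 19, 23, 29, 31, 37, 41, 43, 47, 53, 59, 61, 67, 71, 73, 79, 83, 89, 97, 101, 103, 107,
            109, 113, 127, 131, 137, 139] : List ℕ).filter (· ∣ (2 * j + 1))).map fun p => p - 1).prod *
          (if (2 * j + 1) / (([3, 5, 7, 11, 13, 17, 19, 23, 29, 31, 37, 41, 43, 47, 53, 59, 61, 67, 71, 73, 79, 83, 89, 97, 101, 103,
              107, 109, 113, 127, 131, 137, 139] : List ℕ).filter (· ∣ (2 * j + 1))).prod = 1 then 1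
           else (2 * j + 1) / (([3, 5, 7, 11, 13, 17, 19, 23, 29, 31, 37, 41, 43, 47, 53, 59, 61, 67, 71, 73, 79, 83, 89, 97, 101, 103,
               107, 109, 113, 127, 131, 137,
               139] : List ℕ).filter (· ∣ (2 * j + 1))).prod - 1)) : ℕ)) : ℝ) ≤ (Nat.totient (2 ^ 3 * (2 * j + 1)) : ℝ) := by
          rw [hφ8, hφ]
        have hlt := six_mul_lt_totient_of_crit (f := 2 ^ 3 * (2 * j + 1)) (by rw [e8]; omega) hlog hP hcrit
        have h6 : (Nat.totient (2 ^ 3 * (2 * j + 1)) : ℝ) ≤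
            6 * (Real.pi⁻¹ * Real.sqrt (2 ^ 3 * (2 * j + 1) : ℕ) * Real.log (2 ^ 3 * (2 * j + 1) : ℕ)) :=
          hle.trans (mul_le_mul_of_nonneg_left hT2 (by norm_num))
        exact absurd (h6.trans_lt hlt) (lt_irrefl _)
      · exfalso
        rw [← prods_eight_mul] at htab
        obtain ⟨ps, hps, hprod⟩ := List.mem_map.1 htab
        have hprod' : ps.prod = 2 * j + 1 := by omega
        obtain ⟨hpc, hcert⟩ := cert_eight_mul ps hps
        have hprime : ∀ p ∈ ps, p.Prime := primes_of_cert (n := 2 * j + 1) (by omega) (dvd_of_eq hprod') (by omega) hpc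
        have hnd : ps.Nodup := nodup_of_squarefree_listProd hprime (by rw [hprod']; exact hsqm)
        have hφ : Nat.totient (2 ^ 3 * (2 * j + 1)) = 4 * (ps.map fun p => p - 1).prod := by
          rw [hφ8, ← totient_listProd_eq hprime hnd, hprod']
        have hval : ∀ b : ℕ, b < 2 ^ 3 * (2 * j + 1) → ψ (b : ZMod (2 ^ 3 * (2 * j + 1))) =
            (((if b % 2 = 0 then (0 : ℤ) else if (2 * j + 1) % 4 = 1 then (if b % 8 = 1 ∨ b % 8 = 3 then 1 else -1)
                else (if b % 8 = 1 ∨ b % 8 = 7 then 1 else -1)) *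
              (ps.map fun p => if b % p = 0 then (0 : ℤ) else if b ^ (p / 2) % p = 1 then 1 else -1).prod : ℤ) : ℂ) :=
          fun b _ => apply_natCast_eq_prod_ite_of_eq_eight_mul (m := 2 * j + 1) e8 hm hprim hquad hodd hprime hprod' b
        have hB := norm_bernoulliOneChar_eq_natAbs_halfSum_div_two (f := 2 ^ 3 * (2 * j + 1)) ⟨2 * (2 * j + 1), by ring⟩ hprim
          hquad hval
        have hr2 : 2 ^ 3 * (2 * j + 1) / 2 = 4 * (2 * j + 1) := by rw [e8]; omega
        rw [hr2] at hB
        rw [hprod'] at hcert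
        have hcR : (3 : ℝ) * ((∑ b ∈ Finset.range (4 * (2 * j + 1)),
            (if b % 2 = 0 then (0 : ℤ) else if (2 * j + 1) % 4 = 1 then (if b % 8 = 1 ∨ b % 8 = 3 then 1 else -1)
              else (if b % 8 = 1 ∨ b % 8 = 7 then 1 else -1)) *
            (ps.map fun p => if b % p = 0 then (0 : ℤ) else if b ^ (p / 2) % p = 1 then 1 else -1).prod).natAbs : ℝ) <
            (((4 * (ps.map fun p => p - 1).prod : ℕ)) : ℝ) := by
          exact_mod_cast hcert
        rw [hB, hφ] at hle
        linarith
      · simp only [List.mem_cons, List.mem_nil_iff, or_false] at hsol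
        rw [e8]
        omega

/-- **THE CLASSIFICATION.**  For an odd primitive quadratic Dirichlet character `ψ` of conductor `f` (= the Kronecker symbol `(−f/·)`, `−f`
a fundamental discriminant): **`φ(f) ≤ 6·|B_{1,ψ}|` implies `f ∈ {3, 4, 7, 8, 15, 20, 24, 39, 56, 84}`** — the negative fundamental
discriminants `D` with `12·h(D)/w(D) ≥ φ(|D|)`.  (Conversely each listed conductor attains it: §3.)
[cite: MontgomeryVaughan2007, §9.3 Thm. 9.13] [cite: Oesterle1988Gauss, II §3 (27)] [cite: BauerCosteItzyksonRuelle1997, §3.4] -/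
theorem mem_of_totient_le_six_mul_norm_bernoulliOneChar (hprim : ψ.IsPrimitive) (hquad : ψ.IsQuadratic) (hodd : ψ.Odd)
    (hle : (Nat.totient f : ℝ) ≤ 6 * ‖bernoulliOneChar ψ‖) :
    f ∈ ({3, 4, 7, 8, 15, 20, 24, 39, 56, 84} : Finset ℕ) := by
  rcases Nat.even_or_odd f with hfe | hfo
  · rcases mem_of_totient_le_six_mul_norm_bernoulliOneChar_of_even hfe hprim hquad hodd hle with h | h | h | h | h | h <;>
      simp [h]
  · rcases mem_of_totient_le_six_mul_norm_bernoulliOneChar_of_odd hfo hprim hquad hodd hle with h | h | h | h <;> simp [h]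

end Classification

end Literature.NumberTheory.LFunctions.PrimitiveQuadratic
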